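import Literature.NumberTheory.QuadraticFields.QuadraticOrderLatticeNormalForm
import Literature.NumberTheory.QuadraticFields.BinaryQuadraticFormsRepresentation
import Mathlib.Data.ZMod.QuotientGroup
import Mathlib.RingTheory.Finiteness.Subalgebra
import HarnessLib

/-!
# The Borevich–Faddeev classification of lattices over a quadratic order: the standard form
# `L ≅ R₁ ⊕ ⋯ ⊕ Rₙ₋₁ ⊕ I₁⋯Iₙ`, «chain + class ⟹ isomorphism type», and the uniqueness of the chain
# (Jordan–Keeton–Poonen–Rains–Shepherd-Barron–Tate 2018, Thm. 3.2 (1) uniqueness and (3))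

Topic `Literature/NumberTheory/QuadraticFields`, namespace
`Literature.NumberTheory.QuadraticFields.QuadraticOrderLattice`.  Family `hodge`, lane `lit-hodgefound`
(Track 2 foundations library), seat p18 gen 12, row g12-#1, FILE 2.  Sequel of
`QuadraticOrderLatticeNormalForm` (FILE 1: the chain normal form `L = ⊕ Iᵢyᵢ`,
`(I₀ : I₀) ⊆ ⋯ ⊆ (Iₙ : Iₙ)`, `R(L) = R₀`; the product `I₀⋯Iₙ` is an invertible `Rₙ`-ideal whose class
and whose order `Rₙ` are isomorphism invariants) and of `QuadraticOrderLatticeDecomposition`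
(gen 11).  THEOREMS ONLY — no definition, no named fact (D-0026; net Literature debt 0).
FILE 1 landed as p340315.

## Sources, VERBATIM

* B. W. Jordan, A. G. Keeton, B. Poonen, E. M. Rains, N. Shepherd-Barron, J. T. Tate, *Abelian
  varieties isogenous to a power of an elliptic curve*, Compositio Math. 154 (2018)
  [JKPRST2018IsogenousPowerElliptic] (held text `paper:arxiv-1602.06237`, p. 6), §3.2 Thm. 3.2:
  «Let `R` be a quadratic order […] Let `M` be a f.p. torsion-free `R`-module. • There exists a unique
  chain of orders `R₁ ⊆ ⋯ ⊆ Rₙ` between `R` and `K` and invertible ideals `I₁, …, Iₙ` of `R₁, …, Rₙ`,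
  respectively, such that `M ≅ I₁ ⊕ ⋯ ⊕ Iₙ` as an `R`-module. • The `Iᵢ` are not unique, but their
  product `I₁⋯Iₙ` is an invertible `Rₙ`-ideal whose class `[M] ∈ Pic Rₙ` depends only on `M`. • The
  isomorphism type of `M` is uniquely determined by the chain `R₁ ⊆ ⋯ ⊆ Rₙ` and the class
  `[M] ∈ Pic Rₙ`. *Proof.* See [Borevich–Faddeev 1960].»
* S. Marseglia, *Computing abelian varieties over finite fields isogenous to a power*, Res. Number
  Theory 5 (2019) (held text `paper:arxiv-1808.03673`, pp. 4–5), Thm. 2.3: «Let `R` be a Bass order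
  and let `M` be in `ℬ(r)`. Then there are fractional `R`-ideals `I₁, …, I_r` with
  `(I₁:I₁) ⊆ … ⊆ (I_r:I_r)` such that `M ≃ I₁ ⊕ … ⊕ I_r`. The isomorphism class of `M` is uniquely
  determined by the chain of over-orders `(Iᵢ:Iᵢ)` and the isomorphism class `[I₁⋯I_r]`. […] As an
  immediate consequence […] `M ≃ S₁ ⊕ … ⊕ S_{r−1} ⊕ I`, with `S₁ ⊆ … ⊆ S_{r−1} ⊆ S_r = (I:I)`» and
  Example 2.5 ([BF65]): «Since `I₁` is invertible in `S₁`, there are elements `c₁` and `c₂` in `K`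
  such that `c₁I₁ + c₂I₂ = S₁`. So we can assume that `I₁` and `I₂` are coprime in `S₁`. Thus there
  are `a₁ ∈ I₁` and `a₂ ∈ I₂` such that `1 = a₁ + a₂`. Then it is easy to check that the matrix
  `A₀ = (1 −1; a₂ a₁)` satisfies `A₀(I₁ ⊕ I₂) = S₁ ⊕ I₁I₂`».
* D. A. Cox, *Primes of the form x² + ny²*, 2nd ed. [Cox2013]: §7.A Prop. 7.4 and (7.6)
  `𝔞𝔞′ = (N(α)/a)[1, aτ]` (p01's `QuadraticLattice.exists_order_eq_and_mul_inv_eq`, BY NAME) and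
  §2.C Lemma 2.25 «a primitive form represents integers prime to any given `M`»
  (`Quadratic.BinQF.exists_eval_isCoprime`, BY NAME).

The printed proofs of Borevich–Faddeev (1960, 1965) and Bass (1962) are NOT held — DECLARED DEVIATION:
elementary proofs written for this file, organised as RE-CHOICES OF THE DECOMPOSITION of one and the
same lattice `L ⊆ V` (no abstract module isomorphisms until §10).

## What is formalised (carriers as in FILE 1)

* §6 **coprime representative** (`exists_smul_le_div_self_and_coprime`): for `I = [x, y]` with order
  `𝒪 = (I : I)` and an integer `M ≠ 0` there is `γ ∈ K^×` with `γI ⊆ 𝒪` containing an integer prime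
  to `M` (Cox (7.6) + Lemma 2.25; cf. Cox Cor. 7.17); uniform denominators
  (`exists_nat_mul_mem_span_pair`, private).
* §7 **re-choices of a decomposition**: rescaling the pieces by units (`decomp_rescale`, private) and
  the **absorption** `I ⊕ J ⇝ 𝒪 ⊕ IJ` by the transvection `A₀ = (1 −1; a₂ a₁)` (`decomp_absorb`).
* §8 **one normalisation step** (`decomp_step`): in `L = ⊕ Jᵢzᵢ` two rank-two pieces `J_k`, `J_l` with
  nested orders become `(J_k : J_k)` and `e·J_kJ_l`, `e ∈ K^×`.
* §9 **THE STANDARD FORM** (`exists_standard_decomposition`): from a chain decomposition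
  `L = ⊕ᵢ₌₀ⁿ Iᵢyᵢ`, **`L = R₀z₀ ⊕ ⋯ ⊕ Rₙ₋₁zₙ₋₁ ⊕ (I₀⋯Iₙ)zₙ`**, `Rᵢ = (Iᵢ : Iᵢ)`; auxiliary: the pieces of
  a decomposition are the coefficient lattices (`smul_mem_iff_of_decomp`, O'Meara 81:4), a
  `θ`-stable lattice of `K` is a pair lattice (`exists_eq_span_pair_of_mul_mem`).
* §10 **Thm. 3.2 (3)** (`exists_equiv_of_chain_eq_of_prod_eq`): chain decompositions of `L ⊆ V` and
  `L′ ⊆ V′` with the same orders `(Iᵢ : Iᵢ) = (I′ᵢ : I′ᵢ)` and products in the same class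
  `I′₀⋯I′ₙ = d·I₀⋯Iₙ` give a `K`-linear isomorphism `KL ≅ KL′` carrying `L` onto `L′`
  (`exists_equiv_of_pieces_eq`: equal pieces ⟹ isomorphic).

* §11 **divisibility chains are determined by `e ↦ ∏ gcd(gᵢ, e)`** (`chain_eq_of_prod_gcd_eq`, private).
* §12 **orders inside `[1, θ]` are `[1, gθ]`** (`exists_eq_span_one_natMul`, Cox Lemma 7.2 shape),
  `[1, gθ] ⊆ [1, g′θ] ⟺ g′ ∣ g` (`span_one_natMul_le_iff`), `[1, eθ]·[1, gθ] = [1, gcd(e,g)θ]`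
  (`span_one_natMul_mul_span_one_natMul`).
* §13 `Q·(⊕ Jᵢzᵢ) = ⊕ (QJᵢ)zᵢ` and `f(Q·L) = Q·f(L)` (private).
* §14 **the index** `[⊕ [uᵢ, wᵢ]zᵢ : ⊕ [uᵢ, hᵢwᵢ]zᵢ] = ∏ hᵢ` (`relIndex_eq_prod`, private: transport to
  `∏ (ℤ × hᵢℤ) ⊆ (ℤ²)^{n+1}`, Mathlib's `AddSubgroup.index_pi`, `Int.index_zmultiples`).
* §15 **THE TORSION INVARIANTS AND THE UNIQUENESS OF THE CHAIN**: with `Rₙ = [1, θ]`, `Rᵢ = [1, gᵢθ]`,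
  `[RₙL : (ℤ + eRₙ)L] = ∏_{i<n} gcd(gᵢ, e)` (`relIndex_smul_eq_prod_gcd`), an isomorphism invariant;
  hence **`(Iᵢ : Iᵢ) = (I′ᵢ : I′ᵢ)` for all `i`** whenever `f(L) = L′` for an injective `K`-linear `f`
  (`div_self_eq_of_map_eq`) — Thm. 3.2 (1) «unique chain»; together with FILE 1
  (`exists_prod_eq_smul_prod_of_map_eq`: same class) and §10 this is Thm. 3.2 (3) in both directions.

NOT here (`-- TODO(general form)`): Bass orders beyond the quadratic case (Levy–Wiegand 1985); the
abstract-module packaging (an `R`-module isomorphism `L ≅ L′` is used through its rational extension,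
an injective `K`-linear `f` with `f(L) = L′`).

## References
* [JKPRST2018IsogenousPowerElliptic] Jordan–Keeton–Poonen–Rains–Shepherd-Barron–Tate, Compositio
  Math. 154 (2018), §3.2 Thm. 3.2, p. 6 (= arXiv:1602.06237).
* [Cox2013] D. A. Cox, *Primes of the form x² + ny²*, 2nd ed., §2.C Lemma 2.25; §7.A Prop. 7.4,
  (7.6); §7.C Cor. 7.17.
* [Omeara1963] O. T. O'Meara, *Introduction to Quadratic Forms*, §81B 81:4.
* S. Marseglia, Res. Number Theory 5 (2019), Thm. 2.3, Ex. 2.5 (held `paper:arxiv-1808.03673`);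
  Z. I. Borevich, D. K. Faddeev (1960, 1965); H. Bass, Trans. AMS 102 (1962) (not held).
-/

noncomputable section

open Module Submodule
open scoped Pointwise

namespace Literature.NumberTheory.QuadraticFields

namespace QuadraticOrderLattice

/-! ## §0. Bookkeeping -/

section Bookkeeping

variable {K : Type*} [Field K]

/-- A `ℤ`-submodule of a finitely generated `ℤ`-module is finitely generated. [folklore] -/
private theorem fg_of_le' {M : Type*} [AddCommGroup M] {N L : Submodule ℤ M} (hNL : N ≤ L)
    (hL : L.FG) : N.FG := by
  haveI : IsNoetherian ℤ L := isNoetherian_of_fg_of_noetherian _ hL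
  have h : (N.comap L.subtype).FG := IsNoetherian.noetherian _
  have hmap : (N.comap L.subtype).map L.subtype = N := by
    rw [Submodule.map_comap_subtype, inf_eq_right.2 hNL]
  rw [← hmap]
  exact h.map _

/-- Products of elements of lattices lie in the product lattice. [folklore] -/
private theorem prod_mem_prod' {ι : Type*} [DecidableEq ι] {s : Finset ι} {M : ι → Submodule ℤ K}
    {f : ι → K} (h : ∀ i ∈ s, f i ∈ M i) : (∏ i ∈ s, f i) ∈ ∏ i ∈ s, M i := by
  induction s using Finset.induction_on with
  | empty =>
    rw [Finset.prod_empty, Finset.prod_empty]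
    exact Submodule.mem_one.2 ⟨1, map_one _⟩
  | insert a s ha ih =>
    rw [Finset.prod_insert ha, Finset.prod_insert ha]
    exact Submodule.mul_mem_mul (h a (Finset.mem_insert_self a s))
      (ih fun i hi => h i (Finset.mem_insert_of_mem hi))

end Bookkeeping




/-! ## §6. Denominators and the coprime representative of an invertible class (Cox (7.6) + Lemma 2.25) -/

section Coprime

variable {K : Type*} [Field K] [CharZero K]

/-- **Uniform denominators**: a finitely generated `A ⊆ K` is carried into any full lattice
`[b₁, b₂]` (`b₁, b₂` a `ℚ`-basis of the quadratic field `K`) by a positive integer. [folklore] -/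
private theorem exists_nat_mul_mem_span_pair (h2 : finrank ℚ K = 2) {b₁ b₂ : K}
    (hb : LinearIndependent ℚ ![b₁, b₂]) {A : Submodule ℤ K} (hA : A.FG) :
    ∃ N : ℕ, 0 < N ∧ ∀ a ∈ A, ((N : ℕ) : K) * a ∈ Submodule.span ℤ ({b₁, b₂} : Set K) := by
  classical
  haveI : FiniteDimensional ℚ K := Module.finite_of_finrank_pos (by rw [h2]; norm_num)
  -- `b` is a `ℚ`-basis
  have hcard : Fintype.card (Fin 2) = finrank ℚ K := by rw [h2, Fintype.card_fin]
  let B : Basis (Fin 2) ℚ K := basisOfLinearIndependentOfCardEqFinrank hb hcard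
  have hB : ∀ i, B i = ![b₁, b₂] i := fun i => by
    simp only [B, coe_basisOfLinearIndependentOfCardEqFinrank]
  -- every element has a denominator
  have hden : ∀ a : K, ∃ n : ℕ, 0 < n ∧ ((n : ℕ) : K) * a ∈ Submodule.span ℤ ({b₁, b₂} : Set K) := by
    intro a
    obtain ⟨q₀, q₁, ha⟩ : ∃ q₀ q₁ : ℚ, a = (q₀ : K) * b₁ + (q₁ : K) * b₂ := by
      refine ⟨B.repr a 0, B.repr a 1, ?_⟩
      conv_lhs => rw [← B.sum_repr a]
      rw [Fin.sum_univ_two, hB, hB, Rat.smul_def, Rat.smul_def]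
      rfl
    refine ⟨q₀.den * q₁.den, Nat.mul_pos (Rat.den_pos _) (Rat.den_pos _), ?_⟩
    rw [ha, mul_add, ← mul_assoc, ← mul_assoc]
    refine Submodule.add_mem _ ?_ ?_
    · have h : ((q₀.den * q₁.den : ℕ) : K) * ((q₀ : ℚ) : K) = ((q₁.den : ℤ) * q₀.num : ℤ) := by
        have h0 : (q₀ * q₀.den : ℚ) = q₀.num := Rat.mul_den_eq_num q₀
        have h1 : ((q₀.den * q₁.den : ℕ) : ℚ) * q₀ = ((q₁.den : ℤ) * q₀.num : ℤ) := by
          push_cast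
          linear_combination (q₁.den : ℚ) * h0
        exact_mod_cast congrArg (fun r : ℚ => (r : K)) h1
      rw [h, ← zsmul_eq_mul]
      exact Submodule.smul_mem _ _ (Submodule.subset_span (Set.mem_insert _ _))
    · have h : ((q₀.den * q₁.den : ℕ) : K) * ((q₁ : ℚ) : K) = ((q₀.den : ℤ) * q₁.num : ℤ) := by
        have h0 : (q₁ * q₁.den : ℚ) = q₁.num := Rat.mul_den_eq_num q₁
        have h1 : ((q₀.den * q₁.den : ℕ) : ℚ) * q₁ = ((q₀.den : ℤ) * q₁.num : ℤ) := by
          push_cast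
          linear_combination (q₀.den : ℚ) * h0
        exact_mod_cast congrArg (fun r : ℚ => (r : K)) h1
      rw [h, ← zsmul_eq_mul]
      exact Submodule.smul_mem _ _ (Submodule.subset_span (Set.mem_insert_of_mem _ rfl))
  -- multiply the denominators of a finite generating set
  obtain ⟨s, hs⟩ := hA
  choose n hn hns using hden
  refine ⟨∏ a ∈ s, n a, Finset.prod_pos fun a _ => hn a, ?_⟩
  have hle : A ≤ (Submodule.span ℤ ({b₁, b₂} : Set K)).comap
      (LinearMap.mulLeft ℤ (((∏ a ∈ s, n a : ℕ) : K))) := by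
    rw [← hs, Submodule.span_le]
    intro a ha
    rw [SetLike.mem_coe, Submodule.mem_comap, LinearMap.mulLeft_apply,
      ← Finset.mul_prod_erase s n ha, Nat.cast_mul, mul_comm ((n a : ℕ) : K), mul_assoc,
      ← Int.cast_natCast, ← zsmul_eq_mul]
    exact Submodule.smul_mem _ _ (hns a)
  intro a ha
  exact hle ha

/-- **Every invertible ideal class of a quadratic order contains an ideal coprime to a given
integer** — the lattice form of Cox's «a primitive form represents integers prime to any `M`»
(Lemma 2.25) combined with (7.6) `𝔞𝔞′ = (N(α)/a)𝒪`: for the lattice `I = [x, y]` with order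
`𝒪 = (I : I)` and `M ≠ 0` there is `γ ∈ K^×` with `γI ⊆ 𝒪` and an integer `m ∈ γI` prime to `M`
(so `γI + M𝒪 = 𝒪`).  Here `γ = (a/x)(p + qτ′)` and `m = ap² − bpq + cq²` for Cox's data
`I = x[1, τ]`, `aτ² + bτ + c = 0` primitive, `τ′ = −b/a − τ`, and `(p, q)` from Lemma 2.25.
[cite: Cox2013, §7.A (7.6) with §2.C Lemma 2.25 (cf. §7.C Cor. 7.17), pp. 135–136] -/
theorem exists_smul_le_div_self_and_coprime (h2 : finrank ℚ K = 2) {x y : K}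
    (hli : LinearIndependent ℚ ![x, y]) {M : ℤ} (hM : M ≠ 0) :
    ∃ γ : K, γ ≠ 0 ∧
      γ • Submodule.span ℤ ({x, y} : Set K) ≤
        Submodule.span ℤ ({x, y} : Set K) / Submodule.span ℤ ({x, y} : Set K) ∧
      ∃ m : ℤ, (m : K) ∈ γ • Submodule.span ℤ ({x, y} : Set K) ∧ IsCoprime m M := by
  obtain ⟨a, b, c, τ, ha, hrel, ⟨u, v, w, hbez⟩, hτ, hI, hS, hinv⟩ :=
    QuadraticLattice.exists_order_eq_and_mul_inv_eq h2 hli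
  obtain ⟨hx, -⟩ := QuadraticLattice.ratCast_ne_div_of_linearIndependent hli
  have ha' : (a : K) ≠ 0 := by exact_mod_cast ha
  -- the primitive form `(a, -b, c)`
  have hprim : (⟨a, -b, c⟩ : Quadratic.BinQF).IsPrimitive := by
    rw [Quadratic.BinQF.isPrimitive_iff]
    intro d hda hdb hdc
    have hd : d ∣ u * a + v * b + w * c :=
      dvd_add (dvd_add (dvd_mul_of_dvd_right hda _) (dvd_mul_of_dvd_right (dvd_neg.1 hdb) _))
        (dvd_mul_of_dvd_right hdc _)
    rw [hbez] at hd
    exact isUnit_of_dvd_one hd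
  obtain ⟨p, q, hpq, hcop⟩ := Quadratic.BinQF.exists_eval_isCoprime hprim hM
  have hne : (p : K) + q * (-(b : K) / a - τ) ≠ 0 := by
    intro h0
    by_cases hq : q = 0
    · rw [hq] at hpq h0
      have hp : p ≠ 0 := (isCoprime_zero_right.1 hpq).ne_zero
      simp only [Int.cast_zero, zero_mul, add_zero, Int.cast_eq_zero] at h0
      exact hp h0
    · apply QuadraticLattice.ratCast_ne_conj (a := a) (b := b) hτ (-(p : ℚ) / q)
      have hq' : (q : K) ≠ 0 := by exact_mod_cast hq
      have h1 : -(b : K) / a - τ = -(p : K) / q := by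
        rw [eq_div_iff hq']
        linear_combination h0
      rw [h1]
      push_cast
      ring
  refine ⟨(a : K) / x * (p + q * (-(b : K) / a - τ)), ?_, ?_,
    (⟨a, -b, c⟩ : Quadratic.BinQF).eval p q, ?_, hcop⟩
  · exact mul_ne_zero (div_ne_zero ha' hx) hne
  · have hγ : (a : K) / x * (p + q * (-(b : K) / a - τ)) ∈
        ((a : K) / x) • Submodule.span ℤ ({1, -(b : K) / a - τ} : Set K) :=
      Submodule.smul_mem_pointwise_smul _ _ _ (QuadraticLattice.mem_span_one_pair_iff.2 ⟨p, q, rfl⟩)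
    intro z hz
    obtain ⟨i, hi, rfl⟩ := (Submodule.mem_smul_pointwise_iff_exists _ _ _).1 hz
    rw [hS, ← hinv, smul_eq_mul,
      show (a : K) / x * (p + q * (-(b : K) / a - τ)) * i = i * ((a : K) / x * (p + q * (-(b : K) / a - τ)))
        from mul_comm _ _]
    exact Submodule.mul_mem_mul hi hγ
  · have hmem : x * (p + q * τ) ∈ Submodule.span ℤ ({x, y} : Set K) := by
      rw [hI]
      exact Submodule.smul_mem_pointwise_smul _ _ _
        (QuadraticLattice.mem_span_one_pair_iff.2 ⟨p, q, rfl⟩)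
    have hval : (((⟨a, -b, c⟩ : Quadratic.BinQF).eval p q : ℤ) : K) =
        (a : K) / x * (p + q * (-(b : K) / a - τ)) * (x * (p + q * τ)) := by
      simp only [Quadratic.BinQF.eval]
      push_cast
      field_simp
      linear_combination ((q : K) ^ 2) * hrel
    rw [hval]
    exact Submodule.smul_mem_pointwise_smul _ _ _ hmem

end Coprime

/-! ## §7. Re-choosing a decomposition: rescaling the pieces and the Borevich–Faddeev transvection -/

section Rechoose

variable {K : Type*} [Field K]
variable {V : Type*} [AddCommGroup V] [Module K V]
variable {ι : Type*} [Fintype ι] [DecidableEq ι]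

omit [DecidableEq ι] in
/-- **Rescaling**: `⊕ Iᵢyᵢ = ⊕ (uᵢIᵢ)(uᵢ⁻¹yᵢ)` for units `uᵢ ∈ K^×`. [folklore] -/
private theorem decomp_rescale {L : Submodule ℤ V} {y : ι → V} {I : ι → Submodule ℤ K}
    (hmem : ∀ v : V, v ∈ L ↔ ∃ c : ι → K, (∀ i, c i ∈ I i) ∧ v = ∑ i, c i • y i)
    (u : ι → K) (hu : ∀ i, u i ≠ 0) (v : V) :
    v ∈ L ↔ ∃ c : ι → K, (∀ i, c i ∈ u i • I i) ∧ v = ∑ i, c i • ((u i)⁻¹ • y i) := by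
  rw [hmem]
  constructor
  · rintro ⟨c, hc, rfl⟩
    refine ⟨fun i => u i * c i, fun i => Submodule.smul_mem_pointwise_smul _ _ _ (hc i), ?_⟩
    refine Finset.sum_congr rfl fun i _ => ?_
    have hui := hu i
    rw [smul_smul]
    congr 1
    field_simp
  · rintro ⟨c, hc, rfl⟩
    choose a ha hac using fun i => (Submodule.mem_smul_pointwise_iff_exists _ _ _).1 (hc i)
    refine ⟨a, ha, Finset.sum_congr rfl fun i _ => ?_⟩
    have hui := hu i
    rw [← hac i, smul_eq_mul, smul_smul]
    congr 1
    field_simp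

omit [DecidableEq ι] in
/-- Rescaling by units keeps a family independent. [folklore] -/
private theorem linearIndependent_inv_smul {y : ι → V} (hli : LinearIndependent K y) (u : ι → K)
    (hu : ∀ i, u i ≠ 0) : LinearIndependent K fun i => (u i)⁻¹ • y i := by
  rw [Fintype.linearIndependent_iff] at hli ⊢
  intro g hg i
  have h := hli (fun i => g i * (u i)⁻¹) (by simpa only [mul_smul] using hg) i
  simpa [hu i] using h

/-- Splitting a sum over `ι` at two indices `k ≠ l`. [folklore] -/
private theorem sum_eq_add_add_sum_erase {k l : ι} (hkl : k ≠ l) (f : ι → V) :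
    ∑ i, f i = f k + f l + ∑ i ∈ (Finset.univ.erase k).erase l, f i := by
  rw [add_assoc, Finset.add_sum_erase _ _ (Finset.mem_erase.2 ⟨hkl.symm, Finset.mem_univ l⟩),
    Finset.add_sum_erase _ _ (Finset.mem_univ k)]

/-- **The Borevich–Faddeev transvection on coordinates**: `(c_k, c_l) ↦ (c_k − c_l, a₂c_k + a₁c_l)`
against `(y_k, y_l) ↦ (a₁y_k − a₂y_l, y_k + y_l)` leaves `Σ cᵢyᵢ` unchanged when `a₁ + a₂ = 1`.
[folklore] -/
private theorem sum_transvect_eq {y : ι → V} {k l : ι} (hkl : k ≠ l) {a₁ a₂ : K}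
    (ha : a₁ + a₂ = 1) (c : ι → K) :
    ∑ i, Function.update (Function.update c k (c k - c l)) l (a₂ * c k + a₁ * c l) i •
        Function.update (Function.update y k (a₁ • y k - a₂ • y l)) l (y k + y l) i =
      ∑ i, c i • y i := by
  rw [sum_eq_add_add_sum_erase hkl, sum_eq_add_add_sum_erase hkl (fun i => c i • y i)]
  have hrest : ∑ i ∈ (Finset.univ.erase k).erase l,
      Function.update (Function.update c k (c k - c l)) l (a₂ * c k + a₁ * c l) i •
        Function.update (Function.update y k (a₁ • y k - a₂ • y l)) l (y k + y l) i =
      ∑ i ∈ (Finset.univ.erase k).erase l, c i • y i := by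
    refine Finset.sum_congr rfl fun i hi => ?_
    obtain ⟨hil, hi'⟩ := Finset.mem_erase.1 hi
    obtain ⟨hik, -⟩ := Finset.mem_erase.1 hi'
    simp only [Function.update_of_ne hil, Function.update_of_ne hik]
  rw [hrest]
  congr 1
  simp only [Function.update_self, Function.update_of_ne hkl]
  have ha₁ : a₁ = 1 - a₂ := by rw [← ha]; ring
  subst ha₁
  simp only [smul_sub, smul_add, sub_smul, add_smul, smul_smul, one_smul]
  module

omit [Fintype ι] in
/-- The transvection is invertible: explicit inverse coordinates. [folklore] -/
private theorem transvect_inv {k l : ι} (hkl : k ≠ l) {a₁ a₂ : K} (ha : a₁ + a₂ = 1)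
    {c c' : ι → K}
    (hc : c = Function.update (Function.update c' k (a₁ * c' k + c' l)) l (-a₂ * c' k + c' l)) :
    Function.update (Function.update c k (c k - c l)) l (a₂ * c k + a₁ * c l) = c' := by
  subst hc
  funext i
  rcases eq_or_ne i l with rfl | hil
  · simp only [Function.update_self, Function.update_of_ne hkl]
    linear_combination (c' i) * ha
  · rw [Function.update_of_ne hil]
    rcases eq_or_ne i k with rfl | hik
    · simp only [Function.update_self, Function.update_of_ne hkl]
      linear_combination (c' i) * ha
    · simp only [Function.update_of_ne hik, Function.update_of_ne hil]

/-- **The Borevich–Faddeev absorption step** `I ⊕ J ≅ 𝒪 ⊕ IJ` (Bass 1962; Borevich–Faddeev 1965;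
Marseglia 2019, Example 2.5: «there are `a₁ ∈ I₁` and `a₂ ∈ I₂` such that `1 = a₁ + a₂`. Then …
`A₀ = (1 −1; a₂ a₁)` satisfies `A₀(I₁ ⊕ I₂) = S₁ ⊕ I₁I₂`»), as a RE-CHOICE OF THE DECOMPOSITION of one
and the same lattice `L ⊆ V`: if `L = ⊕ Iᵢyᵢ`, `k ≠ l`, `1 = a₁ + a₂` with `a₁ ∈ I_k`, `a₂ ∈ I_l`,
`I_k, I_l ⊆ 𝒪`, `𝒪I_k ⊆ I_k`, `𝒪I_l ⊆ I_l`, `I_kI_l ⊆ I_l`, then also `L = ⊕ I′ᵢy′ᵢ` with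
`I′_k = 𝒪`, `I′_l = I_kI_l`, `y′_k = a₁y_k − a₂y_l`, `y′_l = y_k + y_l`, the other pieces unchanged.
[cite: JKPRST2018IsogenousPowerElliptic, §3.2 Thm. 3.2 (3), p. 6] -/
theorem decomp_absorb {L : Submodule ℤ V} {y : ι → V} {I : ι → Submodule ℤ K}
    (hmem : ∀ v : V, v ∈ L ↔ ∃ c : ι → K, (∀ i, c i ∈ I i) ∧ v = ∑ i, c i • y i)
    {k l : ι} (hkl : k ≠ l) {S : Submodule ℤ K} {a₁ a₂ : K} (ha : a₁ + a₂ = 1)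
    (ha₁ : a₁ ∈ I k) (ha₂ : a₂ ∈ I l) (hIS : I k ≤ S) (hJS : I l ≤ S)
    (hSI : S * I k ≤ I k) (hSJ : S * I l ≤ I l) (hIJ : I k * I l ≤ I l) (v : V) :
    v ∈ L ↔ ∃ c : ι → K,
      (∀ i, c i ∈ Function.update (Function.update I k S) l (I k * I l) i) ∧
      v = ∑ i, c i • Function.update (Function.update y k (a₁ • y k - a₂ • y l)) l (y k + y l) i := by
  have hIJ' : I k * I l ≤ I k := by
    rw [mul_comm]; exact (mul_le_mul' hJS le_rfl).trans hSI
  rw [hmem]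
  constructor
  · rintro ⟨c, hc, rfl⟩
    refine ⟨Function.update (Function.update c k (c k - c l)) l (a₂ * c k + a₁ * c l), fun i => ?_,
      (sum_transvect_eq hkl ha c).symm⟩
    rcases eq_or_ne i l with rfl | hil
    · rw [Function.update_self, Function.update_self]
      refine Submodule.add_mem _ ?_ (Submodule.mul_mem_mul ha₁ (hc i))
      rw [mul_comm a₂ (c k)]
      exact Submodule.mul_mem_mul (hc k) ha₂
    · rw [Function.update_of_ne hil, Function.update_of_ne hil]
      rcases eq_or_ne i k with rfl | hik
      · rw [Function.update_self, Function.update_self]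
        exact Submodule.sub_mem _ (hIS (hc i)) (hJS (hc l))
      · rw [Function.update_of_ne hik, Function.update_of_ne hik]
        exact hc i
  · rintro ⟨c', hc', rfl⟩
    set c : ι → K := Function.update (Function.update c' k (a₁ * c' k + c' l)) l (-a₂ * c' k + c' l)
      with hc
    refine ⟨c, fun i => ?_, ?_⟩
    · have hk : c' k ∈ S := by
        have := hc' k; rwa [Function.update_of_ne hkl, Function.update_self] at this
      have hl : c' l ∈ I k * I l := by
        have := hc' l; rwa [Function.update_self] at this
      rcases eq_or_ne i l with rfl | hil
      · rw [hc, Function.update_self]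
        refine Submodule.add_mem _ ?_ (hIJ hl)
        rw [neg_mul, mul_comm a₂ (c' k)]
        exact Submodule.neg_mem _ (hSJ (Submodule.mul_mem_mul hk ha₂))
      · rw [hc, Function.update_of_ne hil]
        rcases eq_or_ne i k with rfl | hik
        · rw [Function.update_self]
          refine Submodule.add_mem _ ?_ (hIJ' hl)
          rw [mul_comm a₁ (c' i)]
          exact hSI (Submodule.mul_mem_mul hk ha₁)
        · rw [Function.update_of_ne hik]
          have := hc' i
          rwa [Function.update_of_ne hil, Function.update_of_ne hik] at this
    · rw [← sum_transvect_eq hkl ha c (y := y), transvect_inv hkl ha hc]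

/-- The transvected family is again `K`-independent. [folklore] -/
private theorem linearIndependent_transvect {y : ι → V} (hli : LinearIndependent K y)
    {k l : ι} (hkl : k ≠ l) {a₁ a₂ : K} (ha : a₁ + a₂ = 1) :
    LinearIndependent K
      (Function.update (Function.update y k (a₁ • y k - a₂ • y l)) l (y k + y l)) := by
  rw [Fintype.linearIndependent_iff] at hli ⊢
  intro g hg
  set c : ι → K := Function.update (Function.update g k (a₁ * g k + g l)) l (-a₂ * g k + g l)
    with hc
  have hT := transvect_inv hkl ha hc
  rw [← hT, sum_transvect_eq hkl ha] at hg
  have hc0 : ∀ i, c i = 0 := hli c hg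
  intro i
  rw [← congrFun hT i]
  rcases eq_or_ne i l with rfl | hil
  · rw [Function.update_self, hc0, hc0, mul_zero, mul_zero, add_zero]
  · rw [Function.update_of_ne hil]
    rcases eq_or_ne i k with rfl | hik
    · rw [Function.update_self, hc0, hc0, sub_zero]
    · rw [Function.update_of_ne hik, hc0]

end Rechoose

/-! ## §8. One step of the normalisation: `⋯ ⊕ I_k ⊕ I_l ⊕ ⋯ ⇝ ⋯ ⊕ (I_k : I_k) ⊕ e·I_kI_l ⊕ ⋯` -/

section Step

variable {K : Type*} [Field K] [CharZero K]
variable {V : Type*} [AddCommGroup V] [Module K V]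
variable {ι : Type*} [Fintype ι] [DecidableEq ι]

/-- `1, θ` are `ℚ`-independent for `θ ∉ ℚ`. [folklore] -/
private theorem linearIndependent_one_pair {θ : K} (hθ : ∀ q : ℚ, (q : K) ≠ θ) :
    LinearIndependent ℚ ![(1 : K), θ] := by
  rw [LinearIndependent.pair_iff]
  intro s t h
  by_cases ht : t = 0
  · subst ht
    simp only [zero_smul, add_zero, smul_eq_zero, one_ne_zero, or_false] at h
    exact ⟨h, rfl⟩
  · exfalso
    apply hθ (-s / t)
    have ht' : ((t : ℚ) : K) ≠ 0 := by exact_mod_cast ht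
    rw [Rat.smul_def, Rat.smul_def, mul_one] at h
    push_cast
    rw [div_eq_iff ht']
    linear_combination -h

/-- Scaling a `ℚ`-independent pair by `a ∈ K^×`. [folklore] -/
private theorem linearIndependent_pair_smul {x y : K} (hli : LinearIndependent ℚ ![x, y]) {a : K}
    (ha : a ≠ 0) : LinearIndependent ℚ ![a * x, a * y] := by
  rw [LinearIndependent.pair_iff] at hli ⊢
  intro s t h
  refine hli s t (mul_left_cancel₀ ha ?_)
  rw [mul_zero, mul_add, Rat.smul_def, Rat.smul_def, ← h, Rat.smul_def, Rat.smul_def]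
  ring

omit [CharZero K] in
/-- `a • [x, y] = [ax, ay]`. [folklore] -/
private theorem smul_span_pair (a x y : K) :
    a • Submodule.span ℤ ({x, y} : Set K) = Submodule.span ℤ ({a * x, a * y} : Set K) := by
  rw [Submodule.smul_span, Set.smul_set_insert, Set.smul_set_singleton, smul_eq_mul, smul_eq_mul]

omit [CharZero K] in
/-- Pointwise scaling is monotone. [folklore] -/
private theorem smul_le_smul_of_le {M N : Submodule ℤ K} (h : M ≤ N) (a : K) : a • M ≤ a • N := by
  intro z hz
  obtain ⟨m, hm, rfl⟩ := (Submodule.mem_smul_pointwise_iff_exists _ _ _).1 hz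
  exact Submodule.smul_mem_pointwise_smul _ _ _ (h hm)

/-- **One step of the Borevich–Faddeev normalisation.**  In a decomposition `L = ⊕ Jᵢzᵢ` let `k ≠ l`
be indices whose pieces are rank-two lattices `J_k = [x, y]`, `J_l = [x′, y′]` of the quadratic field
`K` with NESTED orders `(J_k : J_k) ⊆ (J_l : J_l)`.  Then `L` has another decomposition in which the
`k`-th piece is the ORDER `(J_k : J_k)` and the `l`-th piece is `e·J_kJ_l` (`e ∈ K^×`), all other
pieces unchanged: move `J_k` inside its order to a representative `γJ_k` coprime to an integer `M`
with `M(J_k : J_k) ⊆ NJ_l ⊆ (J_k : J_k)` (Cox (7.6) + Lemma 2.25), write `1 = a₁ + a₂`, `a₁ ∈ γJ_k`,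
`a₂ ∈ NJ_l`, and apply the transvection `A₀ = (1 −1; a₂ a₁)` (Marseglia 2019, Ex. 2.5 after
Borevich–Faddeev 1965). [cite: JKPRST2018IsogenousPowerElliptic, §3.2 Thm. 3.2 (3), p. 6] -/
theorem decomp_step (h2 : finrank ℚ K = 2) {L : Submodule ℤ V} {z : ι → V}
    {J : ι → Submodule ℤ K} (hli : LinearIndependent K z)
    (hmem : ∀ v : V, v ∈ L ↔ ∃ c : ι → K, (∀ i, c i ∈ J i) ∧ v = ∑ i, c i • z i)
    {k l : ι} (hkl : k ≠ l) {x y x' y' : K} (hxy : LinearIndependent ℚ ![x, y])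
    (hxy' : LinearIndependent ℚ ![x', y']) (hJk : J k = Submodule.span ℤ ({x, y} : Set K))
    (hJl : J l = Submodule.span ℤ ({x', y'} : Set K)) (hle : J k / J k ≤ J l / J l) :
    ∃ (z' : ι → V) (J' : ι → Submodule ℤ K) (e : K), e ≠ 0 ∧ LinearIndependent K z' ∧
      (∀ v : V, v ∈ L ↔ ∃ c : ι → K, (∀ i, c i ∈ J' i) ∧ v = ∑ i, c i • z' i) ∧
      J' k = J k / J k ∧ J' l = e • (J k * J l) ∧ ∀ i, i ≠ k → i ≠ l → J' i = J i := by
  classical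
  -- the order `S = (J_k : J_k) = [1, aτ]`
  obtain ⟨a, b, c, τ, ha, -, -, hτ, -, hS, -⟩ := QuadraticLattice.exists_order_eq_and_mul_inv_eq h2 hxy
  rw [← hJk] at hS
  set S : Submodule ℤ K := J k / J k with hSdef
  have haτ : ∀ q : ℚ, (q : K) ≠ (a : K) * τ := by
    intro q hq
    apply hτ (q / a)
    have ha' : (a : K) ≠ 0 := by exact_mod_cast ha
    push_cast
    rw [hq, mul_div_cancel_left₀ _ ha']
  have hS1 : LinearIndependent ℚ ![(1 : K), (a : K) * τ] := linearIndependent_one_pair haτ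
  have h1S : (1 : K) ∈ S := QuadraticLattice.one_mem_div_self _
  have hSJk : S * J k ≤ J k := Submodule.le_div_iff_mul_le.1 le_rfl
  have hSJl : S * J l ≤ J l := Submodule.le_div_iff_mul_le.1 hle
  -- (1) `N J_l ⊆ S`
  obtain ⟨N, hN, hNS⟩ := exists_nat_mul_mem_span_pair h2 hS1 (A := J l)
    (by rw [hJl]; exact Submodule.fg_span (Set.toFinite _))
  rw [← hS] at hNS
  have hN' : ((N : ℕ) : K) ≠ 0 := by exact_mod_cast hN.ne'
  have hJ₀S : ((N : ℕ) : K) • J l ≤ S := by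
    intro w hw
    obtain ⟨j, hj, rfl⟩ := (Submodule.mem_smul_pointwise_iff_exists _ _ _).1 hw
    exact hNS j hj
  -- (2) `M S ⊆ N J_l`
  have hJ₀ : ((N : ℕ) : K) • J l = Submodule.span ℤ ({((N : ℕ) : K) * x', ((N : ℕ) : K) * y'} : Set K) := by
    rw [hJl, smul_span_pair]
  obtain ⟨M, hM, hMJ⟩ := exists_nat_mul_mem_span_pair h2 (linearIndependent_pair_smul hxy' hN')
    (A := S) (by rw [hS]; exact Submodule.fg_span (Set.toFinite _))
  rw [← hJ₀] at hMJ
  -- (3) a representative `γ J_k ⊆ S` with an integer `m ∈ γ J_k` prime to `M`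
  have hM0 : (M : ℤ) ≠ 0 := by exact_mod_cast hM.ne'
  obtain ⟨γ, hγ, hγS, m, hm, hcop⟩ := exists_smul_le_div_self_and_coprime h2 hxy hM0
  rw [← hJk] at hγS hm
  obtain ⟨u, v, huv⟩ := hcop
  -- (4) `1 = a₁ + a₂`
  set a₁ : K := ((u * m : ℤ) : K) with ha₁def
  set a₂ : K := ((v * M : ℤ) : K) with ha₂def
  have ha : a₁ + a₂ = 1 := by
    rw [ha₁def, ha₂def]
    exact_mod_cast huv
  have ha₁ : a₁ ∈ γ • J k := by
    rw [ha₁def, Int.cast_mul, ← zsmul_eq_mul]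
    exact Submodule.smul_mem _ _ hm
  have ha₂ : a₂ ∈ ((N : ℕ) : K) • J l := by
    rw [ha₂def, Int.cast_mul, ← zsmul_eq_mul]
    refine Submodule.smul_mem _ _ ?_
    have := hMJ 1 h1S
    rw [mul_one] at this
    rwa [Int.cast_natCast]
  -- (5) rescale: `J₁ = (…, γJ_k, …, NJ_l, …)`
  set uvec : ι → K := Function.update (Function.update (fun _ => (1 : K)) k γ) l ((N : ℕ) : K)
    with huvec
  have huk : uvec k = γ := by rw [huvec, Function.update_of_ne hkl, Function.update_self]
  have hul : uvec l = ((N : ℕ) : K) := by rw [huvec, Function.update_self]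
  have hui : ∀ i, i ≠ k → i ≠ l → uvec i = 1 := fun i hik hil => by
    rw [huvec, Function.update_of_ne hil, Function.update_of_ne hik]
  have hu0 : ∀ i, uvec i ≠ 0 := by
    intro i
    rcases eq_or_ne i l with rfl | hil
    · rw [hul]; exact hN'
    rcases eq_or_ne i k with rfl | hik
    · rw [huk]; exact hγ
    · rw [hui i hik hil]; exact one_ne_zero
  set J₁ : ι → Submodule ℤ K := fun i => uvec i • J i with hJ₁
  set z₁ : ι → V := fun i => (uvec i)⁻¹ • z i with hz₁
  have hmem₁ : ∀ w : V, w ∈ L ↔ ∃ c : ι → K, (∀ i, c i ∈ J₁ i) ∧ w = ∑ i, c i • z₁ i :=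
    decomp_rescale hmem uvec hu0
  have hli₁ : LinearIndependent K z₁ := linearIndependent_inv_smul hli uvec hu0
  have hJ₁k : J₁ k = γ • J k := by simp only [hJ₁, huk]
  have hJ₁l : J₁ l = ((N : ℕ) : K) • J l := by simp only [hJ₁, hul]
  -- (6) absorb
  have hIS : J₁ k ≤ S := by rw [hJ₁k]; exact hγS
  have hJS : J₁ l ≤ S := by rw [hJ₁l]; exact hJ₀S
  have hSI : S * J₁ k ≤ J₁ k := by
    rw [hJ₁k, QuadraticLattice.mul_pointwise_smul]
    exact smul_le_smul_of_le hSJk γ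
  have hSJ : S * J₁ l ≤ J₁ l := by
    rw [hJ₁l, QuadraticLattice.mul_pointwise_smul]
    exact smul_le_smul_of_le hSJl _
  have hIJ : J₁ k * J₁ l ≤ J₁ l := (mul_le_mul' hIS le_rfl).trans hSJ
  refine ⟨Function.update (Function.update z₁ k (a₁ • z₁ k - a₂ • z₁ l)) l (z₁ k + z₁ l),
    Function.update (Function.update J₁ k S) l (J₁ k * J₁ l), γ * ((N : ℕ) : K),
    mul_ne_zero hγ hN', linearIndependent_transvect hli₁ hkl ha,
    decomp_absorb hmem₁ hkl ha (by rw [hJ₁k]; exact ha₁) (by rw [hJ₁l]; exact ha₂) hIS hJS hSI hSJ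
      hIJ, ?_, ?_, fun i hik hil => ?_⟩
  · rw [Function.update_of_ne hkl, Function.update_self]
  · rw [Function.update_self, hJ₁k, hJ₁l, QuadraticLattice.pointwise_smul_mul_pointwise_smul]
  · rw [Function.update_of_ne hil, Function.update_of_ne hik, hJ₁]
    simp only [hui i hik hil, one_smul]

end Step

/-! ## §9. The standard form `L = R₁z₁ ⊕ ⋯ ⊕ Rₙ₋₁zₙ₋₁ ⊕ (I₁⋯Iₙ)zₙ` (JKPRST Thm. 3.2 (3), existence half) -/

section Standard

variable {K : Type*} [Field K] [CharZero K]
variable {V : Type*} [AddCommGroup V] [Module K V]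

omit [CharZero K] in
/-- **The `i`-th coefficient lattice of a decomposition is `Jᵢ`**: `x·zᵢ ∈ L ⟺ x ∈ Jᵢ` (O'Meara 81:4
for any index type and any pieces). [cite: Omeara1963, §81B 81:4, p. 212] -/
theorem smul_mem_iff_of_decomp {ι : Type*} [Fintype ι] [DecidableEq ι] {L : Submodule ℤ V}
    {z : ι → V} {J : ι → Submodule ℤ K} (hli : LinearIndependent K z)
    (hmem : ∀ v : V, v ∈ L ↔ ∃ c : ι → K, (∀ i, c i ∈ J i) ∧ v = ∑ i, c i • z i) (i : ι) (x : K) :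
    x • z i ∈ L ↔ x ∈ J i := by
  constructor
  · intro h
    obtain ⟨c, hc, he⟩ := (hmem _).1 h
    have hz : ∀ j, c j - (Pi.single i x : ι → K) j = 0 := by
      refine Fintype.linearIndependent_iff.1 hli (fun j => c j - (Pi.single i x : ι → K) j) ?_
      simp_rw [sub_smul, Finset.sum_sub_distrib, ← he]
      rw [Finset.sum_eq_single i, Pi.single_eq_same, sub_self]
      · intro j _ hj; rw [Pi.single_eq_of_ne hj, zero_smul]
      · intro hi; exact (hi (Finset.mem_univ i)).elim
    have hci : c i = x := by
      have := hz i
      rwa [Pi.single_eq_same, sub_eq_zero] at this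
    rw [← hci]; exact hc i
  · intro hx
    refine (hmem _).2 ⟨Pi.single i x, fun j => ?_, ?_⟩
    · by_cases hj : j = i
      · subst hj; rwa [Pi.single_eq_same]
      · rw [Pi.single_eq_of_ne hj]; exact Submodule.zero_mem _
    · rw [Finset.sum_eq_single i (fun j _ hj => by rw [Pi.single_eq_of_ne hj, zero_smul])
        (fun h => (h (Finset.mem_univ i)).elim), Pi.single_eq_same]

omit [CharZero K] in
/-- The pieces of a decomposition of a finitely generated lattice are finitely generated
(`J_i ↪ L`, `x ↦ x·zᵢ`). [folklore] -/
private theorem fg_piece {ι : Type*} [Fintype ι] [DecidableEq ι] {L : Submodule ℤ V} (hL : L.FG)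
    {z : ι → V}
    {J : ι → Submodule ℤ K} (hli : LinearIndependent K z)
    (hmem : ∀ v : V, v ∈ L ↔ ∃ c : ι → K, (∀ i, c i ∈ J i) ∧ v = ∑ i, c i • z i) (i : ι) :
    (J i).FG := by
  classical
  let f : K →ₗ[ℤ] V :=
    { toFun := fun x => x • z i, map_add' := fun a b => add_smul a b _,
      map_smul' := fun n a => by rw [RingHom.id_apply, smul_assoc] }
  have hf : Function.Injective f := fun a b h => smul_left_injective K (hli.ne_zero i) h
  refine Submodule.fg_of_fg_map_injective f hf (fg_of_le' ?_ hL)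
  rintro _ ⟨x, hx, rfl⟩
  exact (smul_mem_iff_of_decomp hli hmem i x).2 hx

/-- A finitely generated non-zero lattice of the quadratic field `K` stable under an irrational `θ`
is a rank-two lattice `[x, y]` (reduce to Cox's «`𝔞` is a `ℤ`-module of rank 2, so that
`𝔞 = [α, β]`» for `p⁻¹𝔞 ∋ 1, θ`). [cite: Cox2013, §7.A proof of Prop. 7.4, p. 135] -/
theorem exists_eq_span_pair_of_mul_mem (h2 : finrank ℚ K = 2) {P : Submodule ℤ K} (hP : P.FG)
    (hP0 : P ≠ ⊥) {θ : K} (hθ : ∀ q : ℚ, (q : K) ≠ θ) (hθP : ∀ x ∈ P, θ * x ∈ P) :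
    ∃ x y : K, LinearIndependent ℚ ![x, y] ∧ P = Submodule.span ℤ ({x, y} : Set K) := by
  obtain ⟨p, hp, hp0⟩ := Submodule.exists_mem_ne_zero_of_ne_bot hP0
  -- `p⁻¹ P ∋ 1, θ` is finitely generated
  have hfg : (p⁻¹ • P).FG := by
    obtain ⟨s, hs⟩ := hP
    rw [← hs, Submodule.smul_span]
    exact Submodule.fg_span (s.finite_toSet.smul_set)
  have h1 : (1 : K) ∈ p⁻¹ • P := by
    have := Submodule.smul_mem_pointwise_smul p p⁻¹ P hp
    rwa [smul_eq_mul, inv_mul_cancel₀ hp0] at this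
  have hθ1 : θ ∈ p⁻¹ • P := by
    have := Submodule.smul_mem_pointwise_smul _ p⁻¹ P (hθP p hp)
    rwa [smul_eq_mul, ← mul_assoc, mul_comm p⁻¹, mul_assoc, inv_mul_cancel₀ hp0, mul_one] at this
  obtain ⟨r, y, -, -, heq, hli⟩ := exists_eq_span_ratCast_pair h2 hθ hfg h1 hθ1
  refine ⟨p * r, p * y, linearIndependent_pair_smul hli hp0, ?_⟩
  rw [← smul_span_pair, ← heq, smul_smul, mul_inv_cancel₀ hp0, one_smul]

/-- Prefix products of a chain of pair lattices: `(I₀⋯I_m)𝔫 = (I_m : I_m)` for some `𝔫` and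
`(I₀⋯I_m : I₀⋯I_m) = (I_m : I_m)`. [cite: JKPRST2018IsogenousPowerElliptic, §3.2 Thm. 3.2 (2), p. 6] -/
private theorem prefix_prod_order (h2 : finrank ℚ K = 2) {n : ℕ} {α β : Fin (n + 1) → K}
    (hαβ : ∀ i, LinearIndependent ℚ ![α i, β i])
    (hchain : ∀ i j, i ≤ j →
      Submodule.span ℤ ({α i, β i} : Set K) / Submodule.span ℤ ({α i, β i} : Set K) ≤
        Submodule.span ℤ ({α j, β j} : Set K) / Submodule.span ℤ ({α j, β j} : Set K)) :
    ∀ (m : ℕ) (hm : m ≤ n),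
      (∃ N : Submodule ℤ K,
        (∏ j ∈ Finset.univ.filter (fun j : Fin (n + 1) => (j : ℕ) ≤ m),
            Submodule.span ℤ ({α j, β j} : Set K)) * N =
          Submodule.span ℤ ({α ⟨m, Nat.lt_succ_of_le hm⟩, β ⟨m, Nat.lt_succ_of_le hm⟩} : Set K) /
            Submodule.span ℤ ({α ⟨m, Nat.lt_succ_of_le hm⟩, β ⟨m, Nat.lt_succ_of_le hm⟩} : Set K)) ∧
      (∏ j ∈ Finset.univ.filter (fun j : Fin (n + 1) => (j : ℕ) ≤ m),
            Submodule.span ℤ ({α j, β j} : Set K)) /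
          (∏ j ∈ Finset.univ.filter (fun j : Fin (n + 1) => (j : ℕ) ≤ m),
            Submodule.span ℤ ({α j, β j} : Set K)) =
        Submodule.span ℤ ({α ⟨m, Nat.lt_succ_of_le hm⟩, β ⟨m, Nat.lt_succ_of_le hm⟩} : Set K) /
          Submodule.span ℤ ({α ⟨m, Nat.lt_succ_of_le hm⟩, β ⟨m, Nat.lt_succ_of_le hm⟩} : Set K) := by
  intro m
  induction m with
  | zero =>
    intro hm
    have hset : Finset.univ.filter (fun j : Fin (n + 1) => (j : ℕ) ≤ 0) = {(⟨0, Nat.lt_succ_of_le hm⟩ : Fin (n + 1))} := by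
      ext j
      simp only [Finset.mem_filter, Finset.mem_univ, true_and, Finset.mem_singleton, Nat.le_zero,
        Fin.ext_iff]
    rw [hset, Finset.prod_singleton]
    exact ⟨QuadraticLattice.exists_mul_eq_div_self h2 (hαβ _), rfl⟩
  | succ m ih =>
    intro hm
    obtain ⟨⟨N, hN⟩, hdiv⟩ := ih (Nat.le_of_succ_le hm)
    have hset : Finset.univ.filter (fun j : Fin (n + 1) => (j : ℕ) ≤ m + 1) =
        insert (⟨m + 1, Nat.lt_succ_of_le hm⟩ : Fin (n + 1))
          (Finset.univ.filter (fun j : Fin (n + 1) => (j : ℕ) ≤ m)) := by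
      ext j
      simp only [Finset.mem_filter, Finset.mem_univ, true_and, Finset.mem_insert, Fin.ext_iff]
      omega
    have hnot : (⟨m + 1, Nat.lt_succ_of_le hm⟩ : Fin (n + 1)) ∉
        Finset.univ.filter (fun j : Fin (n + 1) => (j : ℕ) ≤ m) := by
      simp
    rw [hset, Finset.prod_insert hnot, mul_comm]
    obtain ⟨N', hN'⟩ := QuadraticLattice.exists_mul_eq_div_self h2 (hαβ ⟨m + 1, Nat.lt_succ_of_le hm⟩)
    have hle := hdiv.trans_le
      (hchain ⟨m, Nat.lt_succ_of_le (Nat.le_of_succ_le hm)⟩ ⟨m + 1, Nat.lt_succ_of_le hm⟩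
        (Fin.mk_le_mk.2 (Nat.le_succ m)))
    obtain ⟨h1, h2'⟩ := mul_mul_mul_eq_of_div_le (hN.trans hdiv.symm) hN' hle
    exact ⟨⟨_, h1⟩, h2'⟩

/-- The induction behind `exists_standard_decomposition`: after `m` absorption steps the pieces are
`(I₀ : I₀), …, (I_{m−1} : I_{m−1}), d·I₀⋯I_m, I_{m+1}, …, I_n`.
[cite: JKPRST2018IsogenousPowerElliptic, §3.2 Thm. 3.2 (3), p. 6] -/
private theorem standard_aux (h2 : finrank ℚ K = 2) {n : ℕ} {L : Submodule ℤ V} (hL : L.FG)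
    {y : Fin (n + 1) → V} {α β : Fin (n + 1) → K} (hli : LinearIndependent K y)
    (hy : ∀ i, y i ∈ L) (hαβ : ∀ i, LinearIndependent ℚ ![α i, β i])
    (hmem : ∀ v : V, v ∈ L ↔ ∃ c : Fin (n + 1) → K,
      (∀ i, c i ∈ Submodule.span ℤ ({α i, β i} : Set K)) ∧ v = ∑ i, c i • y i)
    (hchain : ∀ i j, i ≤ j →
      Submodule.span ℤ ({α i, β i} : Set K) / Submodule.span ℤ ({α i, β i} : Set K) ≤
        Submodule.span ℤ ({α j, β j} : Set K) / Submodule.span ℤ ({α j, β j} : Set K)) :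
    ∀ m : ℕ, m ≤ n → ∃ (z : Fin (n + 1) → V) (J : Fin (n + 1) → Submodule ℤ K) (d : K),
      d ≠ 0 ∧ LinearIndependent K z ∧
      (∀ v : V, v ∈ L ↔ ∃ c : Fin (n + 1) → K, (∀ i, c i ∈ J i) ∧ v = ∑ i, c i • z i) ∧
      (∀ i : Fin (n + 1), (i : ℕ) < m →
        J i = Submodule.span ℤ ({α i, β i} : Set K) / Submodule.span ℤ ({α i, β i} : Set K)) ∧
      (∀ i : Fin (n + 1), (i : ℕ) = m →
        J i = d • ∏ j ∈ Finset.univ.filter (fun j : Fin (n + 1) => (j : ℕ) ≤ m),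
          Submodule.span ℤ ({α j, β j} : Set K)) ∧
      (∀ i : Fin (n + 1), m < (i : ℕ) → J i = Submodule.span ℤ ({α i, β i} : Set K)) := by
  classical
  -- abbreviation
  set I : Fin (n + 1) → Submodule ℤ K := fun i => Submodule.span ℤ ({α i, β i} : Set K) with hI
  have h1I : ∀ i, (1 : K) ∈ I i := fun i => by
    have := (smul_mem_iff_of_decomp hli hmem i (1 : K)).1 (by rw [one_smul]; exact hy i)
    exact this
  intro m
  induction m with
  | zero =>
    intro _
    refine ⟨y, I, 1, one_ne_zero, hli, hmem, fun i hi => absurd hi (Nat.not_lt_zero _), fun i hi => ?_,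
      fun i _ => rfl⟩
    have hset : Finset.univ.filter (fun j : Fin (n + 1) => (j : ℕ) ≤ 0) = {i} := by
      ext j
      simp only [Finset.mem_filter, Finset.mem_univ, true_and, Finset.mem_singleton, Nat.le_zero,
        Fin.ext_iff, hi]
    rw [hset, Finset.prod_singleton, one_smul]
  | succ m ih =>
    intro hm
    obtain ⟨z, J, d, hd, hliz, hmemz, hJ1, hJ2, hJ3⟩ := ih (Nat.le_of_succ_le hm)
    have hmlt : m < n + 1 := Nat.lt_succ_of_le (Nat.le_of_succ_le hm)
    have hm1lt : m + 1 < n + 1 := Nat.lt_succ_of_le hm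
    set k : Fin (n + 1) := ⟨m, hmlt⟩ with hk
    set l : Fin (n + 1) := ⟨m + 1, hm1lt⟩ with hl
    have hkl : k ≠ l := by simp [hk, hl, Fin.ext_iff]
    set P : Submodule ℤ K := ∏ j ∈ Finset.univ.filter (fun j : Fin (n + 1) => (j : ℕ) ≤ m), I j
      with hP
    have hJk : J k = d • P := hJ2 k rfl
    have hJl : J l = I l := hJ3 l (Nat.lt_succ_self m)
    -- the order of the prefix product is `(I_k : I_k)`
    obtain ⟨-, hdiv⟩ := prefix_prod_order h2 hαβ hchain m (Nat.le_of_succ_le hm)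
    have hdiv' : P / P = I k / I k := hdiv
    have hJkdiv : J k / J k = I k / I k := by rw [hJk, QuadraticLattice.smul_div_smul hd, hdiv']
    -- Cox data of `I_k`: its order is `[1, aτ]`, `aτ ∉ ℚ`
    obtain ⟨a, b, c₀, τ, ha, -, -, hτ, -, hS, -⟩ :=
      QuadraticLattice.exists_order_eq_and_mul_inv_eq h2 (hαβ k)
    have haτ : ∀ q : ℚ, (q : K) ≠ (a : K) * τ := by
      intro q hq
      apply hτ (q / a)
      have ha' : (a : K) ≠ 0 := by exact_mod_cast ha
      push_cast
      rw [hq, mul_div_cancel_left₀ _ ha']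
    have hθP : ∀ x ∈ J k, (a : K) * τ * x ∈ J k := by
      intro x hx
      rw [hJk] at hx ⊢
      obtain ⟨p, hp, rfl⟩ := (Submodule.mem_smul_pointwise_iff_exists _ _ _).1 hx
      rw [smul_eq_mul, mul_left_comm, ← smul_eq_mul]
      refine Submodule.smul_mem_pointwise_smul _ _ _ ?_
      have hOP : (I k / I k) * P ≤ P := by rw [← hdiv']; exact Submodule.le_div_iff_mul_le.1 le_rfl
      refine hOP (Submodule.mul_mem_mul ?_ hp)
      have : (a : K) * τ ∈ Submodule.span ℤ ({1, (a : K) * τ} : Set K) :=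
        QuadraticLattice.self_mem_span_one_pair _
      rw [← hS] at this
      exact this
    have h1P : (1 : K) ∈ P := by
      have := prod_mem_prod' (M := I) (f := fun _ => (1 : K))
        (s := Finset.univ.filter (fun j : Fin (n + 1) => (j : ℕ) ≤ m)) fun i _ => h1I i
      rwa [Finset.prod_const_one] at this
    have hJk0 : J k ≠ ⊥ := by
      intro h0
      have hdmem : d ∈ J k := by
        rw [hJk]
        have := Submodule.smul_mem_pointwise_smul _ d P h1P
        rwa [smul_eq_mul, mul_one] at this
      rw [h0, Submodule.mem_bot] at hdmem
      exact hd hdmem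
    obtain ⟨x, x', hxx, hJk'⟩ :=
      exists_eq_span_pair_of_mul_mem h2 (fg_piece hL hliz hmemz k) hJk0 haτ hθP
    have hle : J k / J k ≤ J l / J l := by
      rw [hJkdiv, hJl]
      exact hchain k l (Fin.mk_le_mk.2 (Nat.le_succ m))
    obtain ⟨z', J', e, he, hli', hmem', hJ'k, hJ'l, hJ'i⟩ :=
      decomp_step h2 hliz hmemz hkl hxx (hαβ l) hJk' hJl hle
    refine ⟨z', J', e * d, mul_ne_zero he hd, hli', hmem', fun i hi => ?_, fun i hi => ?_,
      fun i hi => ?_⟩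
    · -- pieces before `m + 1` are orders
      rcases Nat.lt_succ_iff_lt_or_eq.1 hi with hi' | hi'
      · have hik : i ≠ k := fun h => by rw [h] at hi'; exact lt_irrefl _ hi'
        have hil : i ≠ l := fun h => by rw [h] at hi; exact lt_irrefl _ hi
        rw [hJ'i i hik hil]
        exact hJ1 i hi'
      · have hik : i = k := Fin.ext hi'
        rw [hik, hJ'k, hJkdiv]
    · -- the `(m+1)`-st piece is `e d · I₀⋯I_{m+1}`
      have hil : i = l := Fin.ext hi
      have hset : Finset.univ.filter (fun j : Fin (n + 1) => (j : ℕ) ≤ m + 1) =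
          insert l (Finset.univ.filter (fun j : Fin (n + 1) => (j : ℕ) ≤ m)) := by
        ext j
        simp only [Finset.mem_filter, Finset.mem_univ, true_and, Finset.mem_insert, Fin.ext_iff, hl]
        omega
      have hnot : l ∉ Finset.univ.filter (fun j : Fin (n + 1) => (j : ℕ) ≤ m) := by
        simp [hl]
      rw [hil, hJ'l, hJk, hJl, hset, Finset.prod_insert hnot, QuadraticLattice.pointwise_smul_mul,
        smul_smul, mul_comm (I l)]
    · have hik : i ≠ k := fun h => by rw [h] at hi; exact absurd hi (by simp [hk])
      have hil : i ≠ l := fun h => by rw [h] at hi; exact lt_irrefl _ hi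
      rw [hJ'i i hik hil]
      exact hJ3 i (Nat.lt_of_succ_lt hi)

/-- **THE BOREVICH–FADDEEV STANDARD FORM (JKPRST 2018 Thm. 3.2 (3), existence half; Marseglia 2019
Thm. 2.3: «`M ≃ S₁ ⊕ … ⊕ S_{r−1} ⊕ I` with `S₁ ⊆ … ⊆ S_{r−1} ⊆ S_r = (I:I)`»).**  A lattice `L ⊆ V`
over a quadratic order with a chain decomposition `L = ⊕ Iᵢyᵢ`, `(I₀ : I₀) ⊆ ⋯ ⊆ (Iₙ : Iₙ)`
(`exists_chain_decomposition`) ALSO decomposes as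
**`L = R₀z₀ ⊕ ⋯ ⊕ Rₙ₋₁zₙ₋₁ ⊕ (I₀⋯Iₙ)zₙ`**, `Rᵢ = (Iᵢ : Iᵢ)` the orders of the chain and `I₀⋯Iₙ` the
product — so the isomorphism type of `L` is determined by the chain and the class of the product.
[cite: JKPRST2018IsogenousPowerElliptic, §3.2 Thm. 3.2 (3), p. 6] -/
theorem exists_standard_decomposition (h2 : finrank ℚ K = 2) {n : ℕ} {L : Submodule ℤ V}
    (hL : L.FG) {y : Fin (n + 1) → V} {α β : Fin (n + 1) → K} (hli : LinearIndependent K y)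
    (hy : ∀ i, y i ∈ L) (hαβ : ∀ i, LinearIndependent ℚ ![α i, β i])
    (hmem : ∀ v : V, v ∈ L ↔ ∃ c : Fin (n + 1) → K,
      (∀ i, c i ∈ Submodule.span ℤ ({α i, β i} : Set K)) ∧ v = ∑ i, c i • y i)
    (hchain : ∀ i j, i ≤ j →
      Submodule.span ℤ ({α i, β i} : Set K) / Submodule.span ℤ ({α i, β i} : Set K) ≤
        Submodule.span ℤ ({α j, β j} : Set K) / Submodule.span ℤ ({α j, β j} : Set K)) :
    ∃ z : Fin (n + 1) → V, LinearIndependent K z ∧ (∀ i, z i ∈ L) ∧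
      ∀ v : V, v ∈ L ↔ ∃ c : Fin (n + 1) → K,
        (∀ i : Fin (n + 1), c i ∈ (if (i : ℕ) < n then
            Submodule.span ℤ ({α i, β i} : Set K) / Submodule.span ℤ ({α i, β i} : Set K)
          else ∏ j, Submodule.span ℤ ({α j, β j} : Set K))) ∧
        v = ∑ i, c i • z i := by
  classical
  obtain ⟨z, J, d, hd, hliz, hmemz, hJ1, hJ2, -⟩ := standard_aux h2 hL hli hy hαβ hmem hchain n le_rfl
  set u : Fin (n + 1) → K := fun i => if (i : ℕ) < n then 1 else d⁻¹ with hu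
  have hu0 : ∀ i, u i ≠ 0 := fun i => by
    simp only [hu]
    split_ifs
    · exact one_ne_zero
    · exact inv_ne_zero hd
  have hmem' := decomp_rescale hmemz u hu0
  have hJ' : ∀ i, u i • J i = if (i : ℕ) < n then
      Submodule.span ℤ ({α i, β i} : Set K) / Submodule.span ℤ ({α i, β i} : Set K)
      else ∏ j, Submodule.span ℤ ({α j, β j} : Set K) := by
    intro i
    simp only [hu]
    split_ifs with hi
    · rw [one_smul, hJ1 i hi]
    · have hin : (i : ℕ) = n := by have := i.2; omega
      have hset : Finset.univ.filter (fun j : Fin (n + 1) => (j : ℕ) ≤ n) = Finset.univ := by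
        ext j
        simp only [Finset.mem_filter, Finset.mem_univ, true_and, iff_true]
        have := j.2; omega
      rw [hJ2 i hin, hset, smul_smul, inv_mul_cancel₀ hd, one_smul]
  refine ⟨fun i => (u i)⁻¹ • z i, linearIndependent_inv_smul hliz u hu0, fun i => ?_, fun v => ?_⟩
  · -- `zᵢ ∈ L` since `1` lies in every piece
    show (u i)⁻¹ • z i ∈ L
    rw [← one_smul K ((u i)⁻¹ • z i), hmem']
    refine ⟨Pi.single i 1, fun j => ?_, ?_⟩
    · by_cases hj : j = i
      · subst hj
        rw [Pi.single_eq_same, hJ']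
        split_ifs
        · exact QuadraticLattice.one_mem_div_self _
        · have := prod_mem_prod' (M := fun j => Submodule.span ℤ ({α j, β j} : Set K))
            (f := fun _ => (1 : K)) (s := Finset.univ) fun j _ =>
              (smul_mem_iff_of_decomp hli hmem j (1 : K)).1 (by rw [one_smul]; exact hy j)
          rwa [Finset.prod_const_one] at this
      · rw [Pi.single_eq_of_ne hj]; exact Submodule.zero_mem _
    · rw [Finset.sum_eq_single i (fun j _ hj => by rw [Pi.single_eq_of_ne hj, zero_smul])
        (fun h => (h (Finset.mem_univ i)).elim), Pi.single_eq_same]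
  · rw [hmem']
    simp only [hJ']

end Standard

/-! ## §10. «Chain + class ⟹ isomorphism type» (JKPRST Thm. 3.2 (3)) -/

section Classification

variable {K : Type*} [Field K] [CharZero K]
variable {V : Type*} [AddCommGroup V] [Module K V]
variable {V' : Type*} [AddCommGroup V'] [Module K V']

omit [CharZero K] in
/-- Coordinates with respect to a `K`-independent family are unique. [folklore] -/
private theorem eq_of_sum_smul_eq_sum_smul' {ι : Type*} [Fintype ι] {y : ι → V}
    (hli : LinearIndependent K y) {a b : ι → K} (h : ∑ i, a i • y i = ∑ i, b i • y i) : a = b := by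
  funext i
  have hz := Fintype.linearIndependent_iff.1 hli (fun i => a i - b i) (by
    simp_rw [sub_smul, Finset.sum_sub_distrib, h, sub_self])
  exact sub_eq_zero.1 (hz i)

omit [CharZero K] in
/-- For a decomposition with all `zᵢ ∈ L`, the `zᵢ` span `KL`. [folklore] -/
private theorem span_range_eq_of_decomp {ι : Type*} [Fintype ι] {L : Submodule ℤ V} {z : ι → V}
    {J : ι → Submodule ℤ K} (hz : ∀ i, z i ∈ L)
    (hmem : ∀ v : V, v ∈ L ↔ ∃ c : ι → K, (∀ i, c i ∈ J i) ∧ v = ∑ i, c i • z i) :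
    Submodule.span K (Set.range z) = Submodule.span K (L : Set V) := by
  apply le_antisymm
  · exact Submodule.span_mono (Set.range_subset_iff.2 hz)
  · rw [Submodule.span_le]
    intro v hv
    obtain ⟨c, -, rfl⟩ := (hmem v).1 hv
    exact Submodule.sum_mem _ fun i _ =>
      Submodule.smul_mem _ _ (Submodule.subset_span (Set.mem_range_self i))

omit [CharZero K] in
/-- **Equal pieces ⟹ isomorphic lattices.** Two lattices `L = ⊕ Jᵢzᵢ ⊆ V`, `L′ = ⊕ Jᵢz′ᵢ ⊆ V′` with
the SAME coefficient lattices (`z`, `z′` independent, inside `L`, `L′`) are identified by the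
`K`-linear isomorphism `KL ≅ KL′`, `zᵢ ↦ z′ᵢ` (the mechanism behind «the isomorphism type of `M` is
uniquely determined by …»). [cite: JKPRST2018IsogenousPowerElliptic, §3.2 Thm. 3.2 (3), p. 6] -/
theorem exists_equiv_of_pieces_eq {ι : Type*} [Fintype ι] {L : Submodule ℤ V} {L' : Submodule ℤ V'}
    {z : ι → V} {z' : ι → V'} {J : ι → Submodule ℤ K} (hli : LinearIndependent K z)
    (hli' : LinearIndependent K z') (hz : ∀ i, z i ∈ L) (hz' : ∀ i, z' i ∈ L')
    (hmem : ∀ v : V, v ∈ L ↔ ∃ c : ι → K, (∀ i, c i ∈ J i) ∧ v = ∑ i, c i • z i)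
    (hmem' : ∀ v : V', v ∈ L' ↔ ∃ c : ι → K, (∀ i, c i ∈ J i) ∧ v = ∑ i, c i • z' i) :
    ∃ f : Submodule.span K (L : Set V) ≃ₗ[K] Submodule.span K (L' : Set V'),
      (∀ i, (f ⟨z i, Submodule.subset_span (hz i)⟩ : V') = z' i) ∧
      ∀ v : Submodule.span K (L : Set V), (v : V) ∈ L ↔ (f v : V') ∈ L' := by
  classical
  have hspan := span_range_eq_of_decomp hz hmem
  have hspan' := span_range_eq_of_decomp hz' hmem'
  let b : Basis ι K (Submodule.span K (L : Set V)) :=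
    (Basis.span hli).map (LinearEquiv.ofEq _ _ hspan)
  let b' : Basis ι K (Submodule.span K (L' : Set V')) :=
    (Basis.span hli').map (LinearEquiv.ofEq _ _ hspan')
  have hb : ∀ i, (b i : V) = z i := fun i => by
    simp only [b, Basis.map_apply, LinearEquiv.coe_ofEq_apply, Basis.span_apply]
  have hb' : ∀ i, (b' i : V') = z' i := fun i => by
    simp only [b', Basis.map_apply, LinearEquiv.coe_ofEq_apply, Basis.span_apply]
  refine ⟨b.equiv b' (Equiv.refl ι), fun i => ?_, fun v => ?_⟩
  · have hzi : (⟨z i, Submodule.subset_span (hz i)⟩ : Submodule.span K (L : Set V)) = b i :=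
      Subtype.ext (hb i).symm
    rw [hzi, Basis.equiv_apply, Equiv.refl_apply, hb']
  · -- coordinates of `v` and of `f v`
    have hv : (v : V) = ∑ i, b.repr v i • z i := by
      conv_lhs => rw [← b.sum_repr v]
      simp only [Submodule.coe_sum, Submodule.coe_smul, hb]
    have hfv : ((b.equiv b' (Equiv.refl ι)) v : V') = ∑ i, b.repr v i • z' i := by
      conv_lhs => rw [← b.sum_repr v]
      simp only [map_sum, map_smul, Basis.equiv_apply, Equiv.refl_apply, Submodule.coe_sum,
        Submodule.coe_smul, hb']
    rw [hv, hfv, hmem, hmem']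
    constructor
    · rintro ⟨c, hc, he⟩
      rw [eq_of_sum_smul_eq_sum_smul' hli he]
      exact ⟨c, hc, rfl⟩
    · rintro ⟨c, hc, he⟩
      rw [eq_of_sum_smul_eq_sum_smul' hli' he]
      exact ⟨c, hc, rfl⟩

/-- **JKPRST 2018 Thm. 3.2 (3): the chain and the class determine the isomorphism type.**  Two
lattices `L ⊆ V`, `L′ ⊆ V′` over quadratic orders of `K` with chain decompositions of the same length
whose orders agree term by term, `(Iᵢ : Iᵢ) = (I′ᵢ : I′ᵢ)`, and whose products lie in the same class,
`I′₀⋯I′ₙ = d·I₀⋯Iₙ` (`d ∈ K^×`), are isomorphic: there is a `K`-linear isomorphism `KL ≅ KL′`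
carrying `L` onto `L′` («The isomorphism type of `M` is uniquely determined by the chain
`R₁ ⊆ ⋯ ⊆ Rₙ` and the class `[M] ∈ Pic Rₙ`»; both are put in the standard form
`R₀ ⊕ ⋯ ⊕ Rₙ₋₁ ⊕ I₀⋯Iₙ`). [cite: JKPRST2018IsogenousPowerElliptic, §3.2 Thm. 3.2 (3), p. 6] -/
theorem exists_equiv_of_chain_eq_of_prod_eq (h2 : finrank ℚ K = 2) {n : ℕ}
    {L : Submodule ℤ V} (hL : L.FG) {y : Fin (n + 1) → V} {α β : Fin (n + 1) → K}
    (hli : LinearIndependent K y) (hy : ∀ i, y i ∈ L) (hαβ : ∀ i, LinearIndependent ℚ ![α i, β i])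
    (hmem : ∀ v : V, v ∈ L ↔ ∃ c : Fin (n + 1) → K,
      (∀ i, c i ∈ Submodule.span ℤ ({α i, β i} : Set K)) ∧ v = ∑ i, c i • y i)
    (hchain : ∀ i j, i ≤ j →
      Submodule.span ℤ ({α i, β i} : Set K) / Submodule.span ℤ ({α i, β i} : Set K) ≤
        Submodule.span ℤ ({α j, β j} : Set K) / Submodule.span ℤ ({α j, β j} : Set K))
    {L' : Submodule ℤ V'} (hL' : L'.FG) {y' : Fin (n + 1) → V'} {α' β' : Fin (n + 1) → K}
    (hli' : LinearIndependent K y') (hy' : ∀ i, y' i ∈ L')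
    (hαβ' : ∀ i, LinearIndependent ℚ ![α' i, β' i])
    (hmem' : ∀ v : V', v ∈ L' ↔ ∃ c : Fin (n + 1) → K,
      (∀ i, c i ∈ Submodule.span ℤ ({α' i, β' i} : Set K)) ∧ v = ∑ i, c i • y' i)
    (hchain' : ∀ i j, i ≤ j →
      Submodule.span ℤ ({α' i, β' i} : Set K) / Submodule.span ℤ ({α' i, β' i} : Set K) ≤
        Submodule.span ℤ ({α' j, β' j} : Set K) / Submodule.span ℤ ({α' j, β' j} : Set K))
    (hord : ∀ i, Submodule.span ℤ ({α i, β i} : Set K) / Submodule.span ℤ ({α i, β i} : Set K) =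
      Submodule.span ℤ ({α' i, β' i} : Set K) / Submodule.span ℤ ({α' i, β' i} : Set K))
    {d : K} (hd : d ≠ 0)
    (hprod : (∏ j, Submodule.span ℤ ({α' j, β' j} : Set K)) = d • ∏ j, Submodule.span ℤ ({α j, β j} : Set K)) :
    ∃ f : Submodule.span K (L : Set V) ≃ₗ[K] Submodule.span K (L' : Set V'),
      ∀ v : Submodule.span K (L : Set V), (v : V) ∈ L ↔ (f v : V') ∈ L' := by
  classical
  obtain ⟨z, hliz, hz, hmemz⟩ := exists_standard_decomposition h2 hL hli hy hαβ hmem hchain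
  obtain ⟨z', hliz', hz', hmemz'⟩ := exists_standard_decomposition h2 hL' hli' hy' hαβ' hmem' hchain'
  -- rescale the last vector of `z′` by `d`
  set u : Fin (n + 1) → K := fun i => if (i : ℕ) < n then 1 else d⁻¹ with hu
  have hu0 : ∀ i, u i ≠ 0 := fun i => by
    simp only [hu]
    split_ifs
    · exact one_ne_zero
    · exact inv_ne_zero hd
  have hmemz'' := decomp_rescale hmemz' u hu0
  have hJ : ∀ i : Fin (n + 1), u i • (if (i : ℕ) < n then
      Submodule.span ℤ ({α' i, β' i} : Set K) / Submodule.span ℤ ({α' i, β' i} : Set K)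
      else ∏ j, Submodule.span ℤ ({α' j, β' j} : Set K)) =
      (if (i : ℕ) < n then
        Submodule.span ℤ ({α i, β i} : Set K) / Submodule.span ℤ ({α i, β i} : Set K)
      else ∏ j, Submodule.span ℤ ({α j, β j} : Set K)) := by
    intro i
    simp only [hu]
    split_ifs
    · rw [one_smul, hord]
    · rw [hprod, smul_smul, inv_mul_cancel₀ hd, one_smul]
  have hmem3 : ∀ v : V', v ∈ L' ↔ ∃ c : Fin (n + 1) → K,
      (∀ i : Fin (n + 1), c i ∈ (if (i : ℕ) < n then
        Submodule.span ℤ ({α i, β i} : Set K) / Submodule.span ℤ ({α i, β i} : Set K)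
        else ∏ j, Submodule.span ℤ ({α j, β j} : Set K))) ∧ v = ∑ i, c i • ((u i)⁻¹ • z' i) := by
    intro v
    rw [hmemz'']
    constructor
    · rintro ⟨c, hc, hv⟩
      exact ⟨c, fun i => by rw [← hJ]; exact hc i, hv⟩
    · rintro ⟨c, hc, hv⟩
      exact ⟨c, fun i => by rw [hJ]; exact hc i, hv⟩
  have h1 : (1 : K) ∈ ∏ j, Submodule.span ℤ ({α j, β j} : Set K) := by
    have := prod_mem_prod' (M := fun j => Submodule.span ℤ ({α j, β j} : Set K))
      (f := fun _ => (1 : K)) (s := Finset.univ) fun j _ =>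
        (smul_mem_iff_of_decomp hli hmem j (1 : K)).1 (by rw [one_smul]; exact hy j)
    rwa [Finset.prod_const_one] at this
  have hz'' : ∀ i, (u i)⁻¹ • z' i ∈ L' := by
    intro i
    by_cases hi : (i : ℕ) < n
    · have : u i = 1 := by simp only [hu, hi, if_true]
      rw [this, inv_one, one_smul]; exact hz' i
    · have : u i = d⁻¹ := by simp only [hu, hi, if_false]
      rw [this, inv_inv, smul_mem_iff_of_decomp hliz' hmemz' i d]
      simp only [hi, if_false, hprod]
      have := Submodule.smul_mem_pointwise_smul _ d _ h1
      rwa [smul_eq_mul, mul_one] at this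
  obtain ⟨f, -, hf⟩ := exists_equiv_of_pieces_eq hliz (linearIndependent_inv_smul hliz' u hu0) hz hz''
    hmemz hmem3
  exact ⟨f, hf⟩

end Classification


/-! ## §11. Divisibility chains are determined by their gcd-products -/

section Combinatorics

/-- For a divisibility chain `fₙ ∣ ⋯ ∣ f₀` and `e > 0`: `∏ᵢ gcd(fᵢ, e) = e^(n+1) ⟺ e ∣ fₙ`.
[folklore] -/
private theorem prod_gcd_eq_pow_iff {n : ℕ} (f : Fin (n + 1) → ℕ)
    (hf : ∀ i j : Fin (n + 1), i ≤ j → f j ∣ f i) {e : ℕ} (he : 0 < e) :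
    ∏ i, Nat.gcd (f i) e = e ^ (n + 1) ↔ e ∣ f (Fin.last n) := by
  constructor
  · intro h
    by_contra hnd
    have hlt : Nat.gcd (f (Fin.last n)) e < e := by
      refine lt_of_le_of_ne (Nat.gcd_le_right _ he) fun heq => hnd ?_
      rw [← heq]; exact Nat.gcd_dvd_left _ _
    have hle : ∏ i : Fin n, Nat.gcd (f (Fin.castSucc i)) e ≤ ∏ _i : Fin n, e :=
      Finset.prod_le_prod' fun i _ => Nat.gcd_le_right _ he
    rw [Finset.prod_const, Finset.card_univ, Fintype.card_fin] at hle
    have hlt' : ∏ i, Nat.gcd (f i) e < e ^ (n + 1) := by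
      rw [Fin.prod_univ_castSucc, pow_succ]
      calc (∏ i : Fin n, Nat.gcd (f (Fin.castSucc i)) e) * Nat.gcd (f (Fin.last n)) e
          ≤ e ^ n * Nat.gcd (f (Fin.last n)) e := Nat.mul_le_mul_right _ hle
        _ < e ^ n * e := Nat.mul_lt_mul_of_pos_left hlt (pow_pos he n)
    exact absurd h (ne_of_lt hlt')
  · intro h
    have hall : ∀ i, Nat.gcd (f i) e = e := fun i =>
      Nat.gcd_eq_right (h.trans (hf i (Fin.last n) (Fin.le_last i)))
    simp_rw [hall]
    rw [Finset.prod_const, Finset.card_univ, Fintype.card_fin]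

/-- **A divisibility chain `gₙ₋₁ ∣ ⋯ ∣ g₀` of positive integers is determined by the function
`e ↦ ∏ᵢ gcd(gᵢ, e)`** (the orders of the torsion invariants `RₙL/(L + eRₙL)`). [folklore] -/
private theorem chain_eq_of_prod_gcd_eq : ∀ {n : ℕ} (g g' : Fin n → ℕ),
    (∀ i, 0 < g i) → (∀ i, 0 < g' i) →
    (∀ i j : Fin n, i ≤ j → g j ∣ g i) → (∀ i j : Fin n, i ≤ j → g' j ∣ g' i) →
    (∀ e : ℕ, 0 < e → ∏ i, Nat.gcd (g i) e = ∏ i, Nat.gcd (g' i) e) → g = g'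
  | 0, g, g', _, _, _, _, _ => funext fun i => i.elim0
  | n + 1, g, g', hg, hg', hc, hc', hF => by
    -- the last members agree
    have hlast : g (Fin.last n) = g' (Fin.last n) := by
      apply Nat.dvd_antisymm
      · rw [← prod_gcd_eq_pow_iff g' hc' (hg _), ← hF _ (hg _), prod_gcd_eq_pow_iff g hc (hg _)]
      · rw [← prod_gcd_eq_pow_iff g hc (hg' _), hF _ (hg' _), prod_gcd_eq_pow_iff g' hc' (hg' _)]
    -- cancel the last factor and use the induction hypothesis on the initial segment
    have hinit : (fun i : Fin n => g (Fin.castSucc i)) = fun i => g' (Fin.castSucc i) := by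
      refine chain_eq_of_prod_gcd_eq _ _ (fun i => hg _) (fun i => hg' _)
        (fun i j hij => hc _ _ (by simpa using hij)) (fun i j hij => hc' _ _ (by simpa using hij))
        fun e he => ?_
      have h := hF e he
      rw [Fin.prod_univ_castSucc, Fin.prod_univ_castSucc, hlast] at h
      exact Nat.eq_of_mul_eq_mul_right (Nat.gcd_pos_of_pos_right _ he) h
    funext i
    rcases Fin.eq_castSucc_or_eq_last i with ⟨j, rfl⟩ | rfl
    · exact congrFun hinit j
    · exact hlast

end Combinatorics

/-! ## §12. Orders inside `ℤ + ℤθ` are `ℤ + gℤθ`; products with `ℤ + eℤθ` -/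

section Suborders

variable {K : Type*} [Field K] [CharZero K]

omit [CharZero K] in
/-- **An order contained in `ℤ + ℤθ` is `ℤ + gℤθ`**: a lattice `S ∋ 1` inside `[1, θ]` containing an
irrational element equals `[1, gθ]` for a unique `g ≥ 1` (its index in `[1, θ]`; for orders of a
quadratic field this is the conductor relative to `[1, θ]`).
[cite: Cox2013, §7.A Lemma 7.2 («`𝒪 = [1, fw_K]`»), p. 133] -/
theorem exists_eq_span_one_natMul {θ : K}
    {S : Submodule ℤ K} (h1 : (1 : K) ∈ S) (hS : S ≤ Submodule.span ℤ ({1, θ} : Set K))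
    (hirr : ∃ x ∈ S, ∀ q : ℚ, (q : K) ≠ x) :
    ∃ g : ℕ, 0 < g ∧ S = Submodule.span ℤ ({1, ((g : ℕ) : K) * θ} : Set K) := by
  classical
  -- the `θ`-coordinates of `S` form an ideal of `ℤ`
  let H : Ideal ℤ :=
    { carrier := {b : ℤ | ∃ a : ℤ, (a : K) + b * θ ∈ S}
      zero_mem' := ⟨1, by push_cast; simpa using h1⟩
      add_mem' := fun {b b'} hb hb' => by
        obtain ⟨a, ha⟩ := hb
        obtain ⟨a', ha'⟩ := hb'
        refine ⟨a + a', ?_⟩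
        have := S.add_mem ha ha'
        convert this using 1
        push_cast; ring
      smul_mem' := fun c {b} hb => by
        obtain ⟨a, ha⟩ := hb
        refine ⟨c * a, ?_⟩
        have := S.smul_mem c ha
        rw [zsmul_eq_mul] at this
        convert this using 1
        rw [smul_eq_mul]; push_cast; ring }
  obtain ⟨g₀, hg₀⟩ := (Submodule.IsPrincipal.principal H : ∃ g₀, H = Submodule.span ℤ {g₀})
  have hmemH : ∀ b : ℤ, b ∈ H ↔ (g₀.natAbs : ℤ) ∣ b := fun b => by
    rw [Int.natAbs_dvd, hg₀, Ideal.mem_span_singleton]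
  -- `g₀ ≠ 0` because `S` contains an irrational element
  have hg₀0 : g₀ ≠ 0 := by
    obtain ⟨x, hxS, hxirr⟩ := hirr
    obtain ⟨a, b, hab⟩ := QuadraticLattice.mem_span_one_pair_iff.1 (hS hxS)
    have hb : b ∈ H := ⟨a, by rw [← hab]; exact hxS⟩
    intro h0
    rw [hmemH, h0, Int.natAbs_zero, Nat.cast_zero, zero_dvd_iff] at hb
    apply hxirr a
    rw [hab, hb]; push_cast; ring
  refine ⟨g₀.natAbs, Int.natAbs_pos.2 hg₀0, le_antisymm ?_ ?_⟩
  · intro x hx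
    obtain ⟨a, b, hab⟩ := QuadraticLattice.mem_span_one_pair_iff.1 (hS hx)
    obtain ⟨k, hk⟩ := (hmemH b).1 ⟨a, by rw [← hab]; exact hx⟩
    rw [hab, hk]
    refine QuadraticLattice.mem_span_one_pair_iff.2 ⟨a, k, ?_⟩
    simp only [Int.cast_mul, Int.cast_natCast]; ring
  · rw [Submodule.span_le]
    rintro x (rfl | rfl) <;> rw [SetLike.mem_coe]
    · exact h1
    · obtain ⟨a, ha⟩ := (hmemH g₀.natAbs).2 dvd_rfl
      have := S.sub_mem ha (S.smul_mem a h1)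
      rwa [zsmul_eq_mul, mul_one, add_sub_cancel_left, Int.cast_natCast] at this

/-- `[1, gθ] ⊆ [1, g′θ]` for `θ ∉ ℚ` iff `g′ ∣ g` (orders of a quadratic field are ordered by
divisibility of their conductors: `𝒪 = [1, fw_K]`, `f = [𝒪_K : 𝒪]`).
[cite: Cox2013, §7.A Lemma 7.2 and the conductor, p. 133] -/
theorem span_one_natMul_le_iff {θ : K} (hθ : ∀ q : ℚ, (q : K) ≠ θ) (g g' : ℕ) :
    Submodule.span ℤ ({1, ((g : ℕ) : K) * θ} : Set K) ≤
        Submodule.span ℤ ({1, ((g' : ℕ) : K) * θ} : Set K) ↔ g' ∣ g := by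
  constructor
  · intro h
    have hmem := h (QuadraticLattice.self_mem_span_one_pair (((g : ℕ) : K) * θ))
    obtain ⟨a, b, hab⟩ := QuadraticLattice.mem_span_one_pair_iff.1 hmem
    have hab' : ((0 : ℤ) : K) + ((g : ℤ) : K) * θ = (a : K) + ((b * g' : ℤ) : K) * θ := by
      push_cast at hab ⊢; rw [zero_add, hab]; ring
    obtain ⟨-, hbg⟩ := QuadraticLattice.intCast_add_intCast_mul_inj hθ hab'
    exact Int.natCast_dvd_natCast.1 ⟨b, by rw [hbg]; ring⟩
  · rintro ⟨k, hk⟩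
    rw [Submodule.span_le]
    rintro x (rfl | rfl) <;> rw [SetLike.mem_coe]
    · exact QuadraticLattice.one_mem_span_one_pair _
    · rw [hk, show (((g' * k : ℕ) : ℕ) : K) * θ = (k : ℤ) • (((g' : ℕ) : K) * θ) by
        rw [zsmul_eq_mul]; push_cast; ring]
      exact Submodule.smul_mem _ _ (QuadraticLattice.self_mem_span_one_pair _)

omit [CharZero K] in
/-- `[1, eθ]·[1, gθ] = [1, gcd(e, g)θ]` inside an order `[1, θ]` (`θ² ∈ [1, θ]`). [folklore] -/
private theorem span_one_natMul_mul_span_one_natMul {θ : K}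
    (hθθ : θ * θ ∈ Submodule.span ℤ ({1, θ} : Set K)) (e g : ℕ) :
    Submodule.span ℤ ({1, ((e : ℕ) : K) * θ} : Set K) *
        Submodule.span ℤ ({1, ((g : ℕ) : K) * θ} : Set K) =
      Submodule.span ℤ ({1, ((Nat.gcd e g : ℕ) : K) * θ} : Set K) := by
  obtain ⟨m, t, hθθ'⟩ := QuadraticLattice.mem_span_one_pair_iff.1 hθθ
  obtain ⟨k₁, hk₁⟩ := Nat.gcd_dvd_left e g
  obtain ⟨k₂, hk₂⟩ := Nat.gcd_dvd_right e g
  set d := Nat.gcd e g with hd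
  apply le_antisymm
  · rw [Submodule.span_mul_span, Submodule.span_le]
    intro w hw
    obtain ⟨x, hx, y, hy, rfl⟩ := Set.mem_mul.1 hw
    rw [SetLike.mem_coe]
    rcases hx with rfl | rfl <;> rcases hy with rfl | rfl
    · rw [one_mul]; exact QuadraticLattice.one_mem_span_one_pair _
    · refine QuadraticLattice.mem_span_one_pair_iff.2 ⟨0, k₂, ?_⟩
      conv_lhs => rw [hk₂]
      push_cast; ring
    · refine QuadraticLattice.mem_span_one_pair_iff.2 ⟨0, k₁, ?_⟩
      conv_lhs => rw [hk₁]
      push_cast; ring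
    · -- `eθ · gθ = eg θ² = eg (m + tθ)`
      refine QuadraticLattice.mem_span_one_pair_iff.2 ⟨e * g * m, k₁ * g * t, ?_⟩
      have : ((e : ℕ) : K) * θ * (((g : ℕ) : K) * θ) = (e : K) * g * (θ * θ) := by ring
      rw [this, hθθ', hk₁]
      push_cast; ring
  · rw [Submodule.span_le]
    rintro x (rfl | rfl) <;> rw [SetLike.mem_coe]
    · simpa only [one_mul] using Submodule.mul_mem_mul
        (QuadraticLattice.one_mem_span_one_pair (((e : ℕ) : K) * θ))
        (QuadraticLattice.one_mem_span_one_pair (((g : ℕ) : K) * θ))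
    · -- Bezout: `gcd(e, g) θ = A · (eθ)·1 + B · 1·(gθ)`
      have hb : ((Nat.gcd e g : ℕ) : K) = ((e : ℤ) * Nat.gcdA e g + (g : ℤ) * Nat.gcdB e g : ℤ) := by
        rw [← Nat.gcd_eq_gcd_ab]; norm_cast
      rw [hb, show (((e : ℤ) * Nat.gcdA e g + (g : ℤ) * Nat.gcdB e g : ℤ) : K) * θ =
          (Nat.gcdA e g : ℤ) • (((e : ℕ) : K) * θ * 1) + (Nat.gcdB e g : ℤ) • (1 * (((g : ℕ) : K) * θ)) by
        rw [zsmul_eq_mul, zsmul_eq_mul]; push_cast; ring]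
      exact Submodule.add_mem _
        (Submodule.smul_mem _ _ (Submodule.mul_mem_mul
          (QuadraticLattice.self_mem_span_one_pair _) (QuadraticLattice.one_mem_span_one_pair _)))
        (Submodule.smul_mem _ _ (Submodule.mul_mem_mul
          (QuadraticLattice.one_mem_span_one_pair _) (QuadraticLattice.self_mem_span_one_pair _)))

end Suborders

/-! ## §13. `Q·L` for a decomposed lattice, and its transport under an isomorphism -/

section SmulDecomp

variable {K : Type*} [Field K]
variable {V : Type*} [AddCommGroup V] [Module K V]
variable {V' : Type*} [AddCommGroup V'] [Module K V']

/-- **`Q·(⊕ Jᵢzᵢ) = ⊕ (QJᵢ)zᵢ`** for a lattice `Q ⊆ K` and a decomposed lattice `L ⊆ V`. [folklore] -/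
private theorem mem_smul_iff_of_decomp {ι : Type*} [Fintype ι] [DecidableEq ι] {L : Submodule ℤ V}
    {z : ι → V} {J : ι → Submodule ℤ K} (hli : LinearIndependent K z)
    (hmem : ∀ v : V, v ∈ L ↔ ∃ c : ι → K, (∀ i, c i ∈ J i) ∧ v = ∑ i, c i • z i)
    (Q : Submodule ℤ K) (v : V) :
    v ∈ Q • L ↔ ∃ c : ι → K, (∀ i, c i ∈ Q * J i) ∧ v = ∑ i, c i • z i := by
  constructor
  · intro hv
    refine Submodule.smul_induction_on hv (fun q hq w hw => ?_) (fun x y hx hy => ?_)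
    · obtain ⟨c, hc, rfl⟩ := (hmem w).1 hw
      refine ⟨fun i => q * c i, fun i => Submodule.mul_mem_mul hq (hc i), ?_⟩
      rw [Finset.smul_sum]
      simp_rw [smul_smul]
    · obtain ⟨c, hc, rfl⟩ := hx
      obtain ⟨c', hc', rfl⟩ := hy
      refine ⟨c + c', fun i => Submodule.add_mem _ (hc i) (hc' i), ?_⟩
      rw [← Finset.sum_add_distrib]
      simp_rw [Pi.add_apply, add_smul]
  · rintro ⟨c, hc, rfl⟩
    refine Submodule.sum_mem _ fun i _ => ?_
    have key : ∀ x ∈ Q * J i, x • z i ∈ Q • L := by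
      intro x hx
      induction hx using Submodule.mul_induction_on' with
      | mem_mul_mem q hq j hj =>
        rw [mul_smul]
        exact Submodule.smul_mem_smul hq ((smul_mem_iff_of_decomp hli hmem i j).2 hj)
      | add x _ y _ hx hy => rw [add_smul]; exact Submodule.add_mem _ hx hy
    exact key _ (hc i)

/-- `f(Q·L) = Q·f(L)` for a `K`-linear `f`. [folklore] -/
private theorem map_smul_eq_smul_map (f : V →ₗ[K] V') (Q : Submodule ℤ K) (L : Submodule ℤ V) :
    (Q • L).map (f.restrictScalars ℤ) = Q • L.map (f.restrictScalars ℤ) := by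
  apply le_antisymm
  · rw [Submodule.map_le_iff_le_comap, Submodule.smul_le]
    intro q hq w hw
    rw [Submodule.mem_comap, LinearMap.restrictScalars_apply, map_smul]
    exact Submodule.smul_mem_smul hq ⟨w, hw, rfl⟩
  · rw [Submodule.smul_le]
    rintro q hq _ ⟨w, hw, rfl⟩
    refine ⟨q • w, Submodule.smul_mem_smul hq hw, ?_⟩
    rw [LinearMap.restrictScalars_apply, LinearMap.restrictScalars_apply, map_smul]

end SmulDecomp

/-! ## §14. The index `[⊕ [uᵢ, wᵢ]zᵢ : ⊕ [uᵢ, hᵢwᵢ]zᵢ] = ∏ hᵢ` -/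

section Index

variable {K : Type*} [Field K] [CharZero K]
variable {V : Type*} [AddCommGroup V] [Module K V]

/-- **The relative index of `⊕ [uᵢ, hᵢwᵢ]zᵢ` in `⊕ [uᵢ, wᵢ]zᵢ` is `∏ hᵢ`**: transport along the
injective homomorphism `(aᵢ, bᵢ)ᵢ ↦ Σ (aᵢuᵢ + bᵢwᵢ)zᵢ` from `(ℤ²)^{n+1}`, where the two lattices become
`∏ (ℤ × hᵢℤ) ⊆ ∏ ℤ²`. [folklore] -/
private theorem relIndex_eq_prod {ι : Type*} [Fintype ι] [DecidableEq ι] {z : ι → V}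
    (hli : LinearIndependent K z) {u w : ι → K} (huw : ∀ i, LinearIndependent ℚ ![u i, w i])
    (h : ι → ℕ) {A B : Submodule ℤ V}
    (hA : ∀ v : V, v ∈ A ↔ ∃ c : ι → K,
      (∀ i, c i ∈ Submodule.span ℤ ({u i, w i} : Set K)) ∧ v = ∑ i, c i • z i)
    (hB : ∀ v : V, v ∈ B ↔ ∃ c : ι → K,
      (∀ i, c i ∈ Submodule.span ℤ ({u i, ((h i : ℕ) : K) * w i} : Set K)) ∧ v = ∑ i, c i • z i) :
    B.toAddSubgroup.relIndex A.toAddSubgroup = ∏ i, h i := by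
  classical
  -- the transport homomorphism
  let Φ : (ι → ℤ × ℤ) →+ V :=
    { toFun := fun p => ∑ i, (((p i).1 : K) * u i + ((p i).2 : K) * w i) • z i
      map_zero' := by simp
      map_add' := fun p p' => by
        rw [← Finset.sum_add_distrib]
        refine Finset.sum_congr rfl fun i _ => ?_
        rw [← add_smul]
        congr 1
        simp only [Pi.add_apply, Prod.fst_add, Prod.snd_add]
        push_cast; ring }
  have hΦ : ∀ p : ι → ℤ × ℤ, Φ p = ∑ i, (((p i).1 : K) * u i + ((p i).2 : K) * w i) • z i :=
    fun p => rfl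
  have hinj : Function.Injective Φ := by
    rw [injective_iff_map_eq_zero]
    intro p hp
    rw [hΦ] at hp
    have hc := Fintype.linearIndependent_iff.1 hli _ hp
    funext i
    have hi := hc i
    have h0 : ((p i).1 : ℚ) • u i + ((p i).2 : ℚ) • w i = 0 := by
      rw [Rat.smul_def, Rat.smul_def]; push_cast; exact hi
    obtain ⟨h1, h2⟩ := (LinearIndependent.pair_iff.1 (huw i)) _ _ h0
    exact Prod.ext (by exact_mod_cast h1) (by exact_mod_cast h2)
  -- the two lattices as images
  have hAeq : A.toAddSubgroup = (⊤ : AddSubgroup (ι → ℤ × ℤ)).map Φ := by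
    ext v
    simp only [Submodule.mem_toAddSubgroup, AddSubgroup.mem_map, AddSubgroup.mem_top, true_and, hA,
      hΦ]
    constructor
    · rintro ⟨c, hc, rfl⟩
      choose a b hab using fun i => QuadraticLattice.mem_span_pair_iff_exists_int.1 (hc i)
      exact ⟨fun i => (a i, b i), Finset.sum_congr rfl fun i _ => by rw [hab i]⟩
    · rintro ⟨p, rfl⟩
      exact ⟨fun i => ((p i).1 : K) * u i + ((p i).2 : K) * w i,
        fun i => QuadraticLattice.mem_span_pair_iff_exists_int.2 ⟨_, _, rfl⟩, rfl⟩
  have hBeq : B.toAddSubgroup = (AddSubgroup.pi Set.univ fun i =>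
      (⊤ : AddSubgroup ℤ).prod (AddSubgroup.zmultiples ((h i : ℕ) : ℤ))).map Φ := by
    ext v
    simp only [Submodule.mem_toAddSubgroup, AddSubgroup.mem_map, AddSubgroup.mem_pi, Set.mem_univ,
      true_implies, AddSubgroup.mem_prod, AddSubgroup.mem_top, true_and, hB, hΦ]
    constructor
    · rintro ⟨c, hc, rfl⟩
      choose a b hab using fun i => QuadraticLattice.mem_span_pair_iff_exists_int.1 (hc i)
      refine ⟨fun i => (a i, b i * h i), fun i => ?_, Finset.sum_congr rfl fun i _ => ?_⟩
      · exact AddSubgroup.mem_zmultiples_iff.2 ⟨b i, by rw [smul_eq_mul]⟩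
      · rw [hab i]; push_cast; ring_nf
    · rintro ⟨p, hp, rfl⟩
      choose k hk using fun i => AddSubgroup.mem_zmultiples_iff.1 (hp i)
      refine ⟨fun i => ((p i).1 : K) * u i + ((p i).2 : K) * w i, fun i =>
        QuadraticLattice.mem_span_pair_iff_exists_int.2 ⟨(p i).1, k i, ?_⟩, rfl⟩
      show ((p i).1 : K) * u i + ((p i).2 : K) * w i = _
      rw [← hk i, smul_eq_mul]; push_cast; ring
  rw [hAeq, hBeq, AddSubgroup.relIndex_map_map_of_injective _ _ hinj, AddSubgroup.relIndex_top_right,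
    AddSubgroup.index_pi]
  refine Finset.prod_congr rfl fun i _ => ?_
  rw [AddSubgroup.index_prod, AddSubgroup.index_top, one_mul, Int.index_zmultiples, Int.natAbs_natCast]

end Index

/-! ## §15. Uniqueness of the chain (JKPRST Thm. 3.2 (1), «unique»; (3)) -/

section ChainUnique

variable {K : Type*} [Field K] [CharZero K]
variable {V : Type*} [AddCommGroup V] [Module K V]
variable {V' : Type*} [AddCommGroup V'] [Module K V']

/-- `1, θ` are `ℚ`-independent for `θ ∉ ℚ`. [folklore] -/
private theorem linearIndependent_one_pair' {θ : K} (hθ : ∀ q : ℚ, (q : K) ≠ θ) :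
    LinearIndependent ℚ ![(1 : K), θ] := by
  rw [LinearIndependent.pair_iff]
  intro s t h
  by_cases ht : t = 0
  · subst ht
    simp only [zero_smul, add_zero, smul_eq_zero, one_ne_zero, or_false] at h
    exact ⟨h, rfl⟩
  · exfalso
    apply hθ (-s / t)
    have ht' : ((t : ℚ) : K) ≠ 0 := by exact_mod_cast ht
    rw [Rat.smul_def, Rat.smul_def, mul_one] at h
    push_cast
    rw [div_eq_iff ht']
    linear_combination -h

/-- **The torsion invariants of a lattice in normal form.**  For `L` with a chain decomposition whose
last order is `[1, θ]` and whose earlier orders are `[1, gᵢθ]` (`i < n`), the relative index of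
`[1, eθ]·L` in `[1, θ]·L` — the order of `RₙL/(L + eRₙL)` — is `∏_{i<n} gcd(gᵢ, e)`: in the standard form
`L = ⊕_{i<n} [1, gᵢθ]zᵢ ⊕ Pzₙ` one has `[1, θ]·L = ⊕ [1, θ]zᵢ ⊕ Pzₙ` and
`[1, eθ]·L = ⊕ [1, gcd(e, gᵢ)θ]zᵢ ⊕ Pzₙ`.
[cite: JKPRST2018IsogenousPowerElliptic, §3.2 Thm. 3.2 (1) («unique chain»), p. 6] -/
theorem relIndex_smul_eq_prod_gcd (h2 : finrank ℚ K = 2) {n : ℕ} {L : Submodule ℤ V}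
    (hL : L.FG) {y : Fin (n + 1) → V} {α β : Fin (n + 1) → K} (hli : LinearIndependent K y)
    (hy : ∀ i, y i ∈ L) (hαβ : ∀ i, LinearIndependent ℚ ![α i, β i])
    (hmem : ∀ v : V, v ∈ L ↔ ∃ c : Fin (n + 1) → K,
      (∀ i, c i ∈ Submodule.span ℤ ({α i, β i} : Set K)) ∧ v = ∑ i, c i • y i)
    (hchain : ∀ i j, i ≤ j →
      Submodule.span ℤ ({α i, β i} : Set K) / Submodule.span ℤ ({α i, β i} : Set K) ≤
        Submodule.span ℤ ({α j, β j} : Set K) / Submodule.span ℤ ({α j, β j} : Set K))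
    {θ : K} (hθ : ∀ q : ℚ, (q : K) ≠ θ)
    (hO : Submodule.span ℤ ({α (Fin.last n), β (Fin.last n)} : Set K) /
        Submodule.span ℤ ({α (Fin.last n), β (Fin.last n)} : Set K) =
      Submodule.span ℤ ({1, θ} : Set K))
    {g : Fin n → ℕ}
    (hg : ∀ i : Fin n, Submodule.span ℤ ({α (Fin.castSucc i), β (Fin.castSucc i)} : Set K) /
        Submodule.span ℤ ({α (Fin.castSucc i), β (Fin.castSucc i)} : Set K) =
      Submodule.span ℤ ({1, ((g i : ℕ) : K) * θ} : Set K))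
    (e : ℕ) :
    ((Submodule.span ℤ ({1, ((e : ℕ) : K) * θ} : Set K)) • L).toAddSubgroup.relIndex
        ((Submodule.span ℤ ({1, θ} : Set K)) • L).toAddSubgroup = ∏ i, Nat.gcd (g i) e := by
  classical
  -- `[1, θ]` is an order: `θ² ∈ [1, θ]`
  have h1O : (1 : K) ∈ Submodule.span ℤ ({1, θ} : Set K) := QuadraticLattice.one_mem_span_one_pair θ
  have hOO : Submodule.span ℤ ({1, θ} : Set K) * Submodule.span ℤ ({1, θ} : Set K) ≤
      Submodule.span ℤ ({1, θ} : Set K) := by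
    rw [← hO]; exact QuadraticLattice.div_self_mul_div_self_le _
  have hθθ : θ * θ ∈ Submodule.span ℤ ({1, θ} : Set K) :=
    hOO (Submodule.mul_mem_mul (QuadraticLattice.self_mem_span_one_pair θ)
      (QuadraticLattice.self_mem_span_one_pair θ))
  have hOeO : Submodule.span ℤ ({1, ((e : ℕ) : K) * θ} : Set K) ≤ Submodule.span ℤ ({1, θ} : Set K) := by
    have := (span_one_natMul_le_iff hθ e 1).2 (one_dvd e)
    simpa only [Nat.cast_one, one_mul] using this
  have h1Oe : (1 : K) ∈ Submodule.span ℤ ({1, ((e : ℕ) : K) * θ} : Set K) :=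
    QuadraticLattice.one_mem_span_one_pair _
  -- the product `P`: order `[1, θ]`, finitely generated, non-zero, `θ`-stable — a pair lattice
  obtain ⟨P, hPdef⟩ : ∃ P : Submodule ℤ K, P = ∏ j, Submodule.span ℤ ({α j, β j} : Set K) := ⟨_, rfl⟩
  obtain ⟨-, hdiv⟩ := exists_prod_mul_eq_last h2 hαβ hchain
  have hPO : P / P = Submodule.span ℤ ({1, θ} : Set K) := by rw [hPdef, hdiv, hO]
  have hOP : Submodule.span ℤ ({1, θ} : Set K) * P = P :=
    QuadraticLattice.mul_eq_of_one_mem_of_mul_le h1O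
      (by rw [← hPO]; exact Submodule.le_div_iff_mul_le.1 le_rfl)
  have hOeP : Submodule.span ℤ ({1, ((e : ℕ) : K) * θ} : Set K) * P = P := by
    refine le_antisymm ((mul_le_mul' hOeO le_rfl).trans hOP.le) fun x hx => ?_
    simpa only [one_mul] using Submodule.mul_mem_mul h1Oe hx
  have h1I : ∀ j, (1 : K) ∈ Submodule.span ℤ ({α j, β j} : Set K) := fun j =>
    (smul_mem_iff_of_decomp hli hmem j (1 : K)).1 (by rw [one_smul]; exact hy j)
  have h1P : (1 : K) ∈ P := by
    have := prod_mem_prod' (M := fun j => Submodule.span ℤ ({α j, β j} : Set K))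
      (f := fun _ => (1 : K)) (s := Finset.univ) fun j _ => h1I j
    rwa [Finset.prod_const_one, ← hPdef] at this
  have hPfg : P.FG := by
    rw [hPdef]
    refine Finset.prod_induction _ (fun M : Submodule ℤ K => M.FG) (fun M N hM hN => hM.mul hN) ?_
      (fun j _ => Submodule.fg_span (Set.toFinite _))
    rw [Submodule.one_eq_span]
    exact Submodule.fg_span (Set.toFinite _)
  have hP0 : P ≠ ⊥ := fun h0 => by
    rw [h0, Submodule.mem_bot] at h1P; exact one_ne_zero h1P
  have hθP : ∀ x ∈ P, θ * x ∈ P := fun x hx => by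
    have hθ' : θ ∈ P / P := by rw [hPO]; exact QuadraticLattice.self_mem_span_one_pair θ
    exact (Submodule.mem_div_iff_forall_mul_mem.1 hθ') x hx
  obtain ⟨p₁, p₂, hp, hPeq⟩ := exists_eq_span_pair_of_mul_mem h2 hPfg hP0 hθ hθP
  -- the standard form
  obtain ⟨z, hliz, hz, hmemz⟩ := exists_standard_decomposition h2 hL hli hy hαβ hmem hchain
  rw [← hPdef] at hmemz
  -- the pieces of `[1,θ]·L` and `[1,eθ]·L`
  have hOR : ∀ i : Fin (n + 1), (hi : (i : ℕ) < n) →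
      Submodule.span ℤ ({1, θ} : Set K) *
        (Submodule.span ℤ ({α i, β i} : Set K) / Submodule.span ℤ ({α i, β i} : Set K)) =
      Submodule.span ℤ ({1, θ} : Set K) := by
    intro i hi
    have hRle : Submodule.span ℤ ({α i, β i} : Set K) / Submodule.span ℤ ({α i, β i} : Set K) ≤
        Submodule.span ℤ ({1, θ} : Set K) := by
      rw [← hO]; exact hchain _ _ (Fin.le_last i)
    refine le_antisymm ((mul_le_mul' le_rfl hRle).trans hOO) fun x hx => ?_
    simpa only [mul_one] using Submodule.mul_mem_mul hx (QuadraticLattice.one_mem_div_self _)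
  have hOeR : ∀ i : Fin (n + 1), (hi : (i : ℕ) < n) →
      Submodule.span ℤ ({1, ((e : ℕ) : K) * θ} : Set K) *
        (Submodule.span ℤ ({α i, β i} : Set K) / Submodule.span ℤ ({α i, β i} : Set K)) =
      Submodule.span ℤ ({1, ((Nat.gcd e (g ⟨i, hi⟩) : ℕ) : K) * θ} : Set K) := by
    intro i hi
    have hieq : i = Fin.castSucc ⟨i, hi⟩ := Fin.ext rfl
    conv_lhs => rw [hieq, hg ⟨i, hi⟩]
    exact span_one_natMul_mul_span_one_natMul hθθ e (g ⟨i, hi⟩)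
  -- piece identities in the shape required by `relIndex_eq_prod`
  have hpieceA : ∀ i : Fin (n + 1), Submodule.span ℤ ({1, θ} : Set K) *
      (if (i : ℕ) < n then
        Submodule.span ℤ ({α i, β i} : Set K) / Submodule.span ℤ ({α i, β i} : Set K) else P) =
      Submodule.span ℤ ({(if (i : ℕ) < n then (1 : K) else p₁), (if (i : ℕ) < n then θ else p₂)} : Set K) := by
    intro i
    by_cases hi : (i : ℕ) < n
    · rw [if_pos hi, if_pos hi, if_pos hi, hOR i hi]
    · rw [if_neg hi, if_neg hi, if_neg hi, hOP, hPeq]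
  have hpieceB : ∀ i : Fin (n + 1), Submodule.span ℤ ({1, ((e : ℕ) : K) * θ} : Set K) *
      (if (i : ℕ) < n then
        Submodule.span ℤ ({α i, β i} : Set K) / Submodule.span ℤ ({α i, β i} : Set K) else P) =
      Submodule.span ℤ ({(if (i : ℕ) < n then (1 : K) else p₁),
        (((if hi : (i : ℕ) < n then Nat.gcd e (g ⟨i, hi⟩) else 1 : ℕ) : ℕ) : K) *
          (if (i : ℕ) < n then θ else p₂)} : Set K) := by
    intro i
    by_cases hi : (i : ℕ) < n
    · rw [if_pos hi, if_pos hi, if_pos hi, dif_pos hi, hOeR i hi]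
    · rw [if_neg hi, if_neg hi, if_neg hi, dif_neg hi, hOeP, hPeq, Nat.cast_one, one_mul]
  -- apply the index computation with `u = (1,…,1,p₁)`, `w = (θ,…,θ,p₂)`, `h = (gcd(e,gᵢ),…,1)`
  have key := relIndex_eq_prod hliz
    (u := fun i : Fin (n + 1) => if (i : ℕ) < n then (1 : K) else p₁)
    (w := fun i : Fin (n + 1) => if (i : ℕ) < n then θ else p₂)
    (fun i => by
      by_cases hi : (i : ℕ) < n
      · simp only [hi, if_true]; exact linearIndependent_one_pair' hθ
      · simp only [hi, if_false]; exact hp)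
    (fun i : Fin (n + 1) => if hi : (i : ℕ) < n then Nat.gcd e (g ⟨i, hi⟩) else 1)
    (A := Submodule.span ℤ ({1, θ} : Set K) • L)
    (B := Submodule.span ℤ ({1, ((e : ℕ) : K) * θ} : Set K) • L)
    (fun v => by
      rw [mem_smul_iff_of_decomp hliz hmemz]
      exact exists_congr fun c => and_congr_left fun _ => forall_congr' fun i => by rw [hpieceA i])
    (fun v => by
      rw [mem_smul_iff_of_decomp hliz hmemz]
      exact exists_congr fun c => and_congr_left fun _ => forall_congr' fun i => by rw [hpieceB i])
  rw [key, Fin.prod_univ_castSucc]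
  have hlast : ¬ ((Fin.last n : Fin (n + 1)) : ℕ) < n := by simp
  rw [dif_neg hlast, mul_one]
  refine Finset.prod_congr rfl fun i _ => ?_
  rw [dif_pos (by simp : ((Fin.castSucc i : Fin (n + 1)) : ℕ) < n), Nat.gcd_comm]
  congr 2

omit [CharZero K] in
/-- The torsion invariants are isomorphism invariants: `f` carries `Q·L` onto `Q·f(L)`. [folklore] -/
private theorem relIndex_smul_map_eq (f : V →ₗ[K] V') (hfi : Function.Injective f)
    (Q O : Submodule ℤ K) (L : Submodule ℤ V) :
    (Q • L.map (f.restrictScalars ℤ)).toAddSubgroup.relIndex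
        (O • L.map (f.restrictScalars ℤ)).toAddSubgroup =
      (Q • L).toAddSubgroup.relIndex (O • L).toAddSubgroup := by
  rw [← map_smul_eq_smul_map, ← map_smul_eq_smul_map, Submodule.map_toAddSubgroup,
    Submodule.map_toAddSubgroup]
  exact AddSubgroup.relIndex_map_map_of_injective _ _ hfi

omit [CharZero K] in
/-- `aτ ∉ ℚ` for `a ∈ ℤ ∖ 0`, `τ ∉ ℚ`. [folklore] -/
private theorem ratCast_ne_intMul [CharZero K] {τ : K} (hτ : ∀ q : ℚ, (q : K) ≠ τ) {a : ℤ} (ha : a ≠ 0)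
    (q : ℚ) : (q : K) ≠ (a : K) * τ := by
  intro hq
  apply hτ (q / a)
  have ha' : (a : K) ≠ 0 := by exact_mod_cast ha
  push_cast
  rw [hq, mul_div_cancel_left₀ _ ha']

/-- **JKPRST 2018 Thm. 3.2 (1), UNIQUENESS OF THE CHAIN** («There exists a *unique* chain of orders
`R₁ ⊆ ⋯ ⊆ Rₙ` …»; with FILE 1/FILE 2 this completes Thm. 3.2 (3): isomorphic ⟺ same chain and same
class).  If `L ⊆ V` and `L′ ⊆ V′` are lattices over quadratic orders of `K` with chain decompositions
`L = ⊕ᵢ₌₀ⁿ Iᵢyᵢ`, `L′ = ⊕ᵢ₌₀ⁿ I′ᵢy′ᵢ`, and `f` is an injective `K`-linear map with `f(L) = L′` (the rational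
extension of an isomorphism `L ≅ L′`), then **`(Iᵢ : Iᵢ) = (I′ᵢ : I′ᵢ)` for every `i`**.  Proof: `Rₙ`
agrees by FILE 1 (`= (I₀⋯Iₙ : I₀⋯Iₙ)`, an invariant); writing `Rₙ = [1, θ]` and `Rᵢ = [1, gᵢθ]`, the
isomorphism invariants `[RₙL : [1, eθ]·L] = ∏_{i<n} gcd(gᵢ, e)` (`relIndex_smul_eq_prod_gcd`) determine
the divisibility chain `(gᵢ)`. [cite: JKPRST2018IsogenousPowerElliptic, §3.2 Thm. 3.2 (1), (3), p. 6] -/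
theorem div_self_eq_of_map_eq (h2 : finrank ℚ K = 2) {n : ℕ}
    {L : Submodule ℤ V} (hL : L.FG) {y : Fin (n + 1) → V} {α β : Fin (n + 1) → K}
    (hli : LinearIndependent K y) (hy : ∀ i, y i ∈ L) (hαβ : ∀ i, LinearIndependent ℚ ![α i, β i])
    (hmem : ∀ v : V, v ∈ L ↔ ∃ c : Fin (n + 1) → K,
      (∀ i, c i ∈ Submodule.span ℤ ({α i, β i} : Set K)) ∧ v = ∑ i, c i • y i)
    (hchain : ∀ i j, i ≤ j →
      Submodule.span ℤ ({α i, β i} : Set K) / Submodule.span ℤ ({α i, β i} : Set K) ≤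
        Submodule.span ℤ ({α j, β j} : Set K) / Submodule.span ℤ ({α j, β j} : Set K))
    {L' : Submodule ℤ V'} (hL' : L'.FG) {y' : Fin (n + 1) → V'} {α' β' : Fin (n + 1) → K}
    (hli' : LinearIndependent K y') (hy' : ∀ i, y' i ∈ L')
    (hαβ' : ∀ i, LinearIndependent ℚ ![α' i, β' i])
    (hmem' : ∀ v : V', v ∈ L' ↔ ∃ c : Fin (n + 1) → K,
      (∀ i, c i ∈ Submodule.span ℤ ({α' i, β' i} : Set K)) ∧ v = ∑ i, c i • y' i)
    (hchain' : ∀ i j, i ≤ j →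
      Submodule.span ℤ ({α' i, β' i} : Set K) / Submodule.span ℤ ({α' i, β' i} : Set K) ≤
        Submodule.span ℤ ({α' j, β' j} : Set K) / Submodule.span ℤ ({α' j, β' j} : Set K))
    (f : V →ₗ[K] V') (hfi : Function.Injective f) (hf : L.map (f.restrictScalars ℤ) = L')
    (i : Fin (n + 1)) :
    Submodule.span ℤ ({α i, β i} : Set K) / Submodule.span ℤ ({α i, β i} : Set K) =
      Submodule.span ℤ ({α' i, β' i} : Set K) / Submodule.span ℤ ({α' i, β' i} : Set K) := by
  classical
  -- (a) the largest orders agree (FILE 1: `Rₙ = (I₀⋯Iₙ : I₀⋯Iₙ)` is an invariant)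
  obtain ⟨-, hdiv⟩ := exists_prod_mul_eq_last h2 hαβ hchain
  obtain ⟨-, hdiv'⟩ := exists_prod_mul_eq_last h2 hαβ' hchain'
  have hne : ∀ i, Submodule.span ℤ ({α' i, β' i} : Set K) ≠ ⊥ := by
    intro i h0
    have hα : α' i ∈ Submodule.span ℤ ({α' i, β' i} : Set K) := Submodule.subset_span (Set.mem_insert _ _)
    rw [h0, Submodule.mem_bot] at hα
    exact (hαβ' i).ne_zero 0 (by simpa using hα)
  obtain ⟨-, hRn⟩ := exists_prod_eq_smul_prod_of_map_eq hli' hy hne hmem hmem' f hf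
  have hlast : Submodule.span ℤ ({α' (Fin.last n), β' (Fin.last n)} : Set K) /
        Submodule.span ℤ ({α' (Fin.last n), β' (Fin.last n)} : Set K) =
      Submodule.span ℤ ({α (Fin.last n), β (Fin.last n)} : Set K) /
        Submodule.span ℤ ({α (Fin.last n), β (Fin.last n)} : Set K) := by
    rw [← hdiv', hRn, hdiv]
  -- (b) `Rₙ = [1, θ]`
  obtain ⟨a, b, c, τ, ha, -, -, hτ, -, hO, -⟩ :=
    QuadraticLattice.exists_order_eq_and_mul_inv_eq h2 (hαβ (Fin.last n))
  have hθ : ∀ q : ℚ, (q : K) ≠ (a : K) * τ := ratCast_ne_intMul hτ ha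
  have hO' := hlast.trans hO
  -- (c) the earlier orders are `[1, gᵢθ]`, `[1, g′ᵢθ]`
  have hR : ∀ (α₀ β₀ : Fin (n + 1) → K), (∀ i, LinearIndependent ℚ ![α₀ i, β₀ i]) →
      (∀ i j, i ≤ j → Submodule.span ℤ ({α₀ i, β₀ i} : Set K) / Submodule.span ℤ ({α₀ i, β₀ i} : Set K) ≤
        Submodule.span ℤ ({α₀ j, β₀ j} : Set K) / Submodule.span ℤ ({α₀ j, β₀ j} : Set K)) →
      Submodule.span ℤ ({α₀ (Fin.last n), β₀ (Fin.last n)} : Set K) /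
          Submodule.span ℤ ({α₀ (Fin.last n), β₀ (Fin.last n)} : Set K) =
        Submodule.span ℤ ({1, (a : K) * τ} : Set K) →
      ∀ i : Fin n, ∃ g : ℕ, 0 < g ∧
        Submodule.span ℤ ({α₀ (Fin.castSucc i), β₀ (Fin.castSucc i)} : Set K) /
            Submodule.span ℤ ({α₀ (Fin.castSucc i), β₀ (Fin.castSucc i)} : Set K) =
          Submodule.span ℤ ({1, ((g : ℕ) : K) * ((a : K) * τ)} : Set K) := by
    intro α₀ β₀ hαβ₀ hchain₀ hO₀ i
    obtain ⟨aᵢ, bᵢ, cᵢ, τᵢ, haᵢ, -, -, hτᵢ, -, hSᵢ, -⟩ :=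
      QuadraticLattice.exists_order_eq_and_mul_inv_eq h2 (hαβ₀ (Fin.castSucc i))
    refine exists_eq_span_one_natMul (QuadraticLattice.one_mem_div_self _)
      (by rw [← hO₀]; exact hchain₀ _ _ (Fin.le_last _)) ⟨(aᵢ : K) * τᵢ, ?_, ratCast_ne_intMul hτᵢ haᵢ⟩
    rw [hSᵢ]; exact QuadraticLattice.self_mem_span_one_pair _
  choose g hg0 hg using hR α β hαβ hchain hO
  choose g' hg0' hg' using hR α' β' hαβ' hchain' hO'
  -- (d) both are divisibility chains
  have hgc : ∀ (g₀ : Fin n → ℕ) (α₀ β₀ : Fin (n + 1) → K),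
      (∀ i j, i ≤ j → Submodule.span ℤ ({α₀ i, β₀ i} : Set K) / Submodule.span ℤ ({α₀ i, β₀ i} : Set K) ≤
        Submodule.span ℤ ({α₀ j, β₀ j} : Set K) / Submodule.span ℤ ({α₀ j, β₀ j} : Set K)) →
      (∀ i : Fin n, Submodule.span ℤ ({α₀ (Fin.castSucc i), β₀ (Fin.castSucc i)} : Set K) /
            Submodule.span ℤ ({α₀ (Fin.castSucc i), β₀ (Fin.castSucc i)} : Set K) =
          Submodule.span ℤ ({1, ((g₀ i : ℕ) : K) * ((a : K) * τ)} : Set K)) →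
      ∀ i j : Fin n, i ≤ j → g₀ j ∣ g₀ i := by
    intro g₀ α₀ β₀ hchain₀ hg₀ i j hij
    refine (span_one_natMul_le_iff hθ (g₀ i) (g₀ j)).1 ?_
    rw [← hg₀ i, ← hg₀ j]
    exact hchain₀ _ _ (by simpa using hij)
  -- (e) the torsion invariants agree, hence so do the chains
  have hF : ∀ e : ℕ, 0 < e → ∏ i, Nat.gcd (g i) e = ∏ i, Nat.gcd (g' i) e := fun e _ => by
    rw [← relIndex_smul_eq_prod_gcd h2 hL hli hy hαβ hmem hchain hθ hO hg e,
      ← relIndex_smul_eq_prod_gcd h2 hL' hli' hy' hαβ' hmem' hchain' hθ hO' hg' e, ← hf,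
      relIndex_smul_map_eq f hfi]
  have hgg : g = g' := chain_eq_of_prod_gcd_eq g g' hg0 hg0' (hgc g α β hchain hg)
    (hgc g' α' β' hchain' hg') hF
  -- (f) conclusion
  rcases Fin.eq_castSucc_or_eq_last i with ⟨j, rfl⟩ | rfl
  · rw [hg j, hg' j, hgg]
  · exact hlast.symm

end ChainUnique

end QuadraticOrderLattice

end Literature.NumberTheory.QuadraticFields
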